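import Literature.Probability.RandomPlanarGeometry.HexSAWSurfaceWallRenewalSlackFourFourDownHyp
import Literature.Probability.RandomPlanarGeometry.HexSAWSurfaceWallRenewalSlackFourFourDownGeometry
import HarnessLib

/-!
# Hexagonal-lattice SAWs at a surface: slack four — the constraint systems of the four-down blocks from their geometry

Wall-renewal blocks of the brick-wall (hexagonal) half-plane walk (`ipwb m`: irreducible positive wall bridges of
length `m`) at slack four, `m = 6k + 4` with `k` visits, with four down steps that stay off the wall inside the
block come in the four vertical orders `D D D D U U U U` (rows `−1 … −4 … −1`), `D D D U D U U U`,
`D D D U U D U U`, `D D U D D U U U`. `…SlackFourFourDownRuns` gives their run decompositions (`dddduuuu4_runs`, …),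
`…SlackFourFourDownHyp` names the arithmetic constraint system of each order (`Dddduuuu4Hyp`, `Ddduduuu4Hyp`,
`Ddduuduu4Hyp`, `Ddudduuu4Hyp`) and `…SlackFourFourDownIntTable<order>` solves it. This module DERIVES the systems
from the geometry:

* `dddduuuu4_hyp`, `ddduduuu4_hyp`, `ddduuduu4_hyp`, `ddudduuu4_hyp` — for every block of the order with `k ≥ 2` the
  step columns `c₁ … c₇ = ω t₂ 0, …, ω t₈ 0` (vertical steps in time order `t₁ = p₁ < t₂ < … < t₈ = r₄`) are natural
  numbers, the visit count reads `r₄ + 2k + 1 = m + p₁`, and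
  `<Order>4Hyp k p₁ (m − r₄ − 1) (t₂ − t₁ − 1) … (t₈ − t₇ − 1) c₁ … c₇` holds.

The geometric inputs are the order-free lemmas of `…SlackFourFourDownGeometry` — the two shields forced by
irreducibility (`four_down_shield_low/high`), separation of two runs on a shared row (`row_runs_apart` +
self-avoidance), the resurfacing column (`resurface_right_of_initial_run`) — applied to the pairs of runs that share
a row in each order; parities come from the brick-wall frame (`…4_runs`), the range from the bridge property. Each
proof is that of `ddduuu4_families` (`…SlackFourThreeDownSystems`) with seven runs, ending in the structure instead
of the table: the integer columns are introduced by `Int.eq_ofNat_of_zero_le` and every field is one `omega` over a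
context holding at most one disjunction.

STATUS: lane theorem of the a-idea-1 bridge/renewal lineage, car 98 «four-down systems» — step (iv) of the
classification of the four-down stratum of the slack-four row (FINDING-HEX-WALL-SLACK-FOUR-LAW:
`12·#{#stepsD = 4} = (k−2)(2k⁴ − 7k³ + 4k² + 7k + 6)`); composed with the tables it gives the parameter systems of
the block tables A7–A15, and the identification with the table walks (wrappers, next module) closes the law. OURS
(elementary). Sources: the renewal / irreducible-bridge structure [MS] Madras–Slade §4.2 (Definition 4.2.1, p. 90;
remark before (4.2.21), p. 94), the brick-wall frame [EJ] Enting–Jensen §7.4.2, Fig. 7.10 — neither contains these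
systems.
-/

namespace Literature.Probability.RandomPlanarGeometry.SAW.HexBW.Wall

open Finset Filter Function
open Literature.Probability.LatticeModels Literature.Probability.Percolation SimpleGraph

variable {ω : ℕ → Site 2}

/-- Two coordinates determine a site of `ℤ²` (plumbing). [folklore] -/
private theorem site_ext_d4s {p q : Site 2} (h0 : p 0 = q 0) (h1 : p 1 = q 1) : p = q := by
  funext k
  fin_cases k
  · exact h0
  · exact h1

/-- **The constraint system of a `D D D D U U U U` block at slack four.** For an irreducible positive wall bridge of
length `6k + 4` (`k ≥ 2`) with `k` wall visits and vertical steps in the order `D D D D U U U U` (down times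
`p₁ < p₂ < p₃ < p₄`, up times `r₁ < r₂ < r₃ < r₄`), the columns `c₁ … c₇` of the vertical steps 2, …, 8 are natural
numbers and, with `p = p₁`, `f = m − r₄ − 1` and the run lengths `hⱼ = tⱼ₊₁ − tⱼ − 1`, satisfy `Dddduuuu4Hyp`
(`…SlackFourFourDownHyp`): LEN, VIS (`r₄ + 2k + 1 = m + p₁`), PAR (brick-wall parities of the step columns and of
`X`), positive runs, SIGNS (the runs of `dddduuuu4_runs`), ROWS (runs 3, 5 on row `−3`; runs 2, 6 on row `−2`; runs
1, 7 on row `−1`: `row_runs_apart` + self-avoidance), WALL (`resurface_right_of_initial_run`), XRNG (bridge), IRR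
(`four_down_shield_low/high`). Four-down analogue of `ddduuu4_families` (`…SlackFourThreeDownSystems`) up to the
table. OURS. [cite: MadrasSlade1993, §4.2, Definition 4.2.1 (p. 90), remark before (4.2.21) (p. 94)]
[cite: EntingJensen2009, §7.4.2, Fig. 7.10] -/
theorem dddduuuu4_hyp {k m : ℕ}
    (hk : 2 ≤ k) (hm : m = 6 * k + 4) (hω : ω ∈ ipwb m) (hv : visits m ω = k) {p₁ p₂ p₃ p₄ r₁ r₂ r₃ r₄ : ℕ}
    (hD : stepsD m ω = {p₁, p₂, p₃, p₄}) (hU : stepsU m ω = {r₁, r₂, r₃, r₄}) (h12 : p₁ < p₂) (h23 : p₂ < p₃)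
    (h34 : p₃ < p₄) (hr12 : r₁ < r₂) (hr23 : r₂ < r₃) (hr34 : r₃ < r₄) (ht4 : p₄ < r₁) (hp1 : 1 ≤ p₁)
    (hR0 : ∀ i, i ≤ p₁ → ω i 0 = i ∧ ω i 1 = 0) (hP1x : ω (p₁ + 1) 0 = p₁) (hP1y : ω (p₁ + 1) 1 = -1)
    (hhor : ∀ i, i < m → i ∉ stepsD m ω → i ∉ stepsU m ω → ω (i + 1) 1 = ω i 1 ∧
        (ω (i + 1) 0 = ω i 0 + 1 ∨ ω (i + 1) 0 = ω i 0 - 1)) :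
    ∃ c1 c2 c3 c4 c5 c6 c7 : ℕ, (c1 : ℤ) = ω p₂ 0 ∧ (c2 : ℤ) = ω p₃ 0 ∧ (c3 : ℤ) = ω p₄ 0 ∧ (c4 : ℤ) = ω r₁ 0 ∧
      (c5 : ℤ) = ω r₂ 0 ∧ (c6 : ℤ) = ω r₃ 0 ∧ (c7 : ℤ) = ω r₄ 0 ∧ r₄ + 2 * k + 1 = m + p₁ ∧
      Dddduuuu4Hyp k p₁ (m - r₄ - 1) (p₂ - p₁ - 1) (p₃ - p₂ - 1) (p₄ - p₃ - 1) (r₁ - p₄ - 1) (r₂ - r₁ - 1)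
          (r₃ - r₂ - 1) (r₄ - r₃ - 1) c1 c2 c3 c4 c5 c6 c7 := by
  classical
  obtain ⟨hpw, hn1, hirr⟩ := mem_ipwb.1 hω
  obtain ⟨hw, hbr⟩ := mem_pwb.1 hpw
  obtain ⟨ha, -⟩ := mem_wbr.1 hw
  obtain ⟨hh, -, -⟩ := mem_archs.1 ha
  obtain ⟨hs, hhp⟩ := mem_hpw.1 hh
  obtain ⟨h0, -, hbw, hinj⟩ := mem_saws_iff.1 hs
  have hX0 : ω 0 0 = 0 := by rw [h0]; rfl
  have hb' : ∀ i, 1 ≤ i → i ≤ m → 0 < ω i 0 ∧ ω i 0 ≤ ω m 0 := fun i h1 h2 => by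
    have := hbr i h1 h2; rwa [hX0] at this
  have hmem : ∀ i, i ≤ m → i ∈ {i | i ≤ m} := fun i hi => hi
  have hmD : ∀ i, i ∈ stepsD m ω ↔ i = p₁ ∨ i = p₂ ∨ i = p₃ ∨ i = p₄ := fun i => by
    rw [hD]; simp only [Finset.mem_insert, Finset.mem_singleton]
  obtain ⟨-, -, -, hppar1⟩ := of_mem_stepsD_coord hbw (i := p₁) ((hmD _).2 (by simp))
  have hpodd : p₁ % 2 = 1 := by rw [hP1x, hP1y] at hppar1; omega
  obtain ⟨e₁, e₂, e₃, e₄, e₅, e₆, e₇, he₁, he₂, he₃, he₄, he₅, he₆, he₇, hrun1, hrun2, hrun3, hrun4, hrun5,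
      hrun6, hrun7, hR8, hs_eq, hN, hq2, hq3, hq4, hq5, hq6, hq7, hq8, hx2, hx3, hx4, hx5, hx6, hx7,
      hg1, hg2, hg3, hg4, hr4m⟩ :=
    dddduuuu4_runs hm hω hv hD hU h12 h23 h34 hr12 hr23 hr34 ht4 hp1 hR0 hP1x hP1y hhor
  -- the end columns of the seven body runs and of the final run; `X` is even
  have hb1 := (hrun1 p₂ (Nat.succ_le_of_lt h12) le_rfl).1
  have hb2 := (hrun2 p₃ (Nat.succ_le_of_lt h23) le_rfl).1
  have hb3 := (hrun3 p₄ (Nat.succ_le_of_lt h34) le_rfl).1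
  have hb4 := (hrun4 r₁ (Nat.succ_le_of_lt ht4) le_rfl).1
  have hb5 := (hrun5 r₂ (Nat.succ_le_of_lt hr12) le_rfl).1
  have hb6 := (hrun6 r₃ (Nat.succ_le_of_lt hr23) le_rfl).1
  have hb7 := (hrun7 r₄ (Nat.succ_le_of_lt hr34) le_rfl).1
  have hM := (hR8 m (Nat.succ_le_of_lt hr4m) le_rfl).1
  -- WALL: the resurfacing column lies right of the initial run
  have hwall : (p₁ : ℤ) + 1 ≤ ω r₄ 0 :=
    resurface_right_of_initial_run hinj (fun i h1 h2 => (hb' i h1 h2).1)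
        (by clear * - h12 h23 h34 ht4 hr12 hr23 hr34; omega) hr4m hR0
      hR8
  -- ROWS: the runs sharing a row are separated (self-avoidance)
  have hrow35 := row_runs_apart (a := ω p₃ 0) (c := ω r₁ 0) he₃ he₅ (Nat.succ_le_of_lt h34)
    (Nat.succ_le_of_lt hr12) (fun i h1 h2 => (hrun3 i h1 h2).1) (fun j h1 h2 => (hrun5 j h1 h2).1)
    (fun i j hi1 hi2 hj1 hj2 hx => by
      have := hinj (hmem i (by clear * - hi2 ht4 hr12 hr23 hr34 hr4m; omega))
          (hmem j (by clear * - hj2 hr12 hr23 hr34 hr4m; omega))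
        (site_ext_d4s hx (by rw [(hrun3 i hi1 hi2).2, (hrun5 j hj1 hj2).2]))
      clear * - this hi2 hj1 ht4
      omega)
  have hrow26 := row_runs_apart (a := ω p₂ 0) (c := ω r₂ 0) he₂ he₆ (Nat.succ_le_of_lt h23)
    (Nat.succ_le_of_lt hr23) (fun i h1 h2 => (hrun2 i h1 h2).1) (fun j h1 h2 => (hrun6 j h1 h2).1)
    (fun i j hi1 hi2 hj1 hj2 hx => by
      have := hinj (hmem i (by clear * - hi2 h34 ht4 hr12 hr23 hr34 hr4m; omega))
          (hmem j (by clear * - hj2 hr23 hr34 hr4m; omega))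
        (site_ext_d4s hx (by rw [(hrun2 i hi1 hi2).2, (hrun6 j hj1 hj2).2]))
      clear * - this hi2 hj1 h34 ht4 hr12
      omega)
  have hrow17 := row_runs_apart (a := (p₁ : ℤ)) (c := ω r₃ 0) he₁ he₇ (Nat.succ_le_of_lt h12)
    (Nat.succ_le_of_lt hr34) (fun i h1 h2 => (hrun1 i h1 h2).1) (fun j h1 h2 => (hrun7 j h1 h2).1)
    (fun i j hi1 hi2 hj1 hj2 hx => by
      have := hinj (hmem i (by clear * - hi2 h23 h34 ht4 hr12 hr23 hr34 hr4m; omega))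
          (hmem j (by clear * - hj2 hr34 hr4m; omega))
        (site_ext_d4s hx (by rw [(hrun1 i hi1 hi2).2, (hrun7 j hj1 hj2).2]))
      clear * - this hi2 hj1 h23 h34 ht4 hr12 hr23
      omega)
  -- SIGNS, sign-free
  have E1 : ω p₂ 0 = p₁ + ((p₂ - p₁ - 1 : ℕ) : ℤ) ∨ ω p₂ 0 + ((p₂ - p₁ - 1 : ℕ) : ℤ) = p₁ := by
    clear * - he₁ hb1 h12; rcases he₁ with rfl | rfl <;> omega
  have E2 : ω p₃ 0 = ω p₂ 0 + ((p₃ - p₂ - 1 : ℕ) : ℤ) ∨ ω p₃ 0 + ((p₃ - p₂ - 1 : ℕ) : ℤ) = ω p₂ 0 := by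
    clear * - he₂ hb2 h23; rcases he₂ with rfl | rfl <;> omega
  have E3 : ω p₄ 0 = ω p₃ 0 + ((p₄ - p₃ - 1 : ℕ) : ℤ) ∨ ω p₄ 0 + ((p₄ - p₃ - 1 : ℕ) : ℤ) = ω p₃ 0 := by
    clear * - he₃ hb3 h34; rcases he₃ with rfl | rfl <;> omega
  have E4 : ω r₁ 0 = ω p₄ 0 + ((r₁ - p₄ - 1 : ℕ) : ℤ) ∨ ω r₁ 0 + ((r₁ - p₄ - 1 : ℕ) : ℤ) = ω p₄ 0 := by
    clear * - he₄ hb4 ht4; rcases he₄ with rfl | rfl <;> omega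
  have E5 : ω r₂ 0 = ω r₁ 0 + ((r₂ - r₁ - 1 : ℕ) : ℤ) ∨ ω r₂ 0 + ((r₂ - r₁ - 1 : ℕ) : ℤ) = ω r₁ 0 := by
    clear * - he₅ hb5 hr12; rcases he₅ with rfl | rfl <;> omega
  have E6 : ω r₃ 0 = ω r₂ 0 + ((r₃ - r₂ - 1 : ℕ) : ℤ) ∨ ω r₃ 0 + ((r₃ - r₂ - 1 : ℕ) : ℤ) = ω r₂ 0 := by
    clear * - he₆ hb6 hr23; rcases he₆ with rfl | rfl <;> omega
  have E7 : ω r₄ 0 = ω r₃ 0 + ((r₄ - r₃ - 1 : ℕ) : ℤ) ∨ ω r₄ 0 + ((r₄ - r₃ - 1 : ℕ) : ℤ) = ω r₃ 0 := by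
    clear * - he₇ hb7 hr34; rcases he₇ with rfl | rfl <;> omega
  -- IRR: the two shields
  have hlo : p₁ ≤ 2 ∨ ω p₂ 0 ≤ 2 ∨ ω p₃ 0 ≤ 2 ∨ ω p₄ 0 ≤ 2 ∨ ω r₁ 0 ≤ 2 ∨ ω r₂ 0 ≤ 2 ∨ ω r₃ 0 ≤ 2 := by
    rcases Nat.lt_or_ge p₁ 3 with h | h
    · exact Or.inl (by clear * - h; omega)
    · exact Or.inr (four_down_shield_low hbr hirr hR0 he₁ he₂ he₃ he₄ he₅ he₆ he₇
        (fun i h1 h2 => (hrun1 i h1 h2).1) (fun i h1 h2 => (hrun2 i h1 h2).1) (fun i h1 h2 => (hrun3 i h1 h2).1)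
        (fun i h1 h2 => (hrun4 i h1 h2).1) (fun i h1 h2 => (hrun5 i h1 h2).1) (fun i h1 h2 => (hrun6 i h1 h2).1)
        (fun i h1 h2 => (hrun7 i h1 h2).1) hR8 h h12 h23 h34 ht4 hr12 hr23 hr34 hr4m hwall)
  have hhi : m - r₄ - 1 ≤ 2 ∨ ω m 0 ≤ ω p₂ 0 + 1 ∨ ω m 0 ≤ ω p₃ 0 + 1 ∨ ω m 0 ≤ ω p₄ 0 + 1 ∨
      ω m 0 ≤ ω r₁ 0 + 1 ∨ ω m 0 ≤ ω r₂ 0 + 1 ∨ ω m 0 ≤ ω r₃ 0 + 1 := by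
    rcases Nat.lt_or_ge (m - r₄ - 1) 3 with h | h
    · exact Or.inl (by clear * - h; omega)
    · exact Or.inr (four_down_shield_high hbr hirr hR0 he₁ he₂ he₃ he₄ he₅ he₆ he₇
        (fun i h1 h2 => (hrun1 i h1 h2).1) (fun i h1 h2 => (hrun2 i h1 h2).1) (fun i h1 h2 => (hrun3 i h1 h2).1)
        (fun i h1 h2 => (hrun4 i h1 h2).1) (fun i h1 h2 => (hrun5 i h1 h2).1) (fun i h1 h2 => (hrun6 i h1 h2).1)
        (fun i h1 h2 => (hrun7 i h1 h2).1) hR8 (by clear * - h hr4m; omega) (by clear * - hm; omega) h12 h23 h34 ht4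
        hr12 hr23 hr34 hwall)
  -- XRNG: the bridge range
  have hX1 := (hb' p₂ (by clear * - hp1 h12; omega) (by clear * - h23 h34 ht4 hr12 hr23 hr34 hr4m; omega)).2
  have hX2 := (hb' p₃ (by clear * - hp1 h12 h23; omega) (by clear * - h34 ht4 hr12 hr23 hr34 hr4m; omega)).2
  have hX3 := (hb' p₄ (by clear * - hp1 h12 h23 h34; omega) (by clear * - ht4 hr12 hr23 hr34 hr4m; omega)).2
  have hX4 := (hb' r₁ (by clear * - hp1 h12 h23 h34 ht4; omega) (by clear * - hr12 hr23 hr34 hr4m; omega)).2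
  have hX5 := (hb' r₂ (by clear * - hp1 h12 h23 h34 ht4 hr12; omega) (by clear * - hr23 hr34 hr4m; omega)).2
  have hX6 := (hb' r₃ (by clear * - hp1 h12 h23 h34 ht4 hr12 hr23; omega) (by clear * - hr34 hr4m; omega)).2
  -- integer columns, then the fields of the system one by one (each `omega` sees few disjunctions)
  obtain ⟨c1, hC1⟩ := Int.eq_ofNat_of_zero_le hx2.le
  obtain ⟨c2, hC2⟩ := Int.eq_ofNat_of_zero_le hx3.le
  obtain ⟨c3, hC3⟩ := Int.eq_ofNat_of_zero_le hx4.le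
  obtain ⟨c4, hC4⟩ := Int.eq_ofNat_of_zero_le hx5.le
  obtain ⟨c5, hC5⟩ := Int.eq_ofNat_of_zero_le hx6.le
  obtain ⟨c6, hC6⟩ := Int.eq_ofNat_of_zero_le hx7.le
  obtain ⟨c7, hC7⟩ := Int.eq_ofNat_of_zero_le (show (0 : ℤ) ≤ ω r₄ 0 by clear * - hwall; omega)
  clear hrun1 hrun2 hrun3 hrun4 hrun5 hrun6 hrun7 hR8 hhor hmD hR0 hb' hbr hirr he₁ he₂ he₃ he₄ he₅ he₆ he₇ hppar1
    hP1x hP1y hmem hinj hbw hb1 hb2 hb3 hb4 hb5 hb6 hb7 hpw hw ha hh hs hhp h0 hX0 hn1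
  refine ⟨c1, c2, c3, c4, c5, c6, c7, hC1.symm, hC2.symm, hC3.symm, hC4.symm, hC5.symm, hC6.symm, hC7.symm, hs_eq, ?_⟩
  have row35 : (c2 < c4 ∧ c2 < c5 ∧ c3 < c4 ∧ c3 < c5) ∨ (c4 < c2 ∧ c5 < c2 ∧ c4 < c3 ∧ c5 < c3) := by
    clear * - hrow35 hC2 hC3 hC4 hC5; omega
  have row26 : (c1 < c5 ∧ c1 < c6 ∧ c2 < c5 ∧ c2 < c6) ∨ (c5 < c1 ∧ c6 < c1 ∧ c5 < c2 ∧ c6 < c2) := by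
    clear * - hrow26 hC1 hC2 hC5 hC6; omega
  have row17 : (p₁ < c6 ∧ p₁ < c7 ∧ c1 < c6 ∧ c1 < c7) ∨ (c6 < p₁ ∧ c7 < p₁ ∧ c6 < c1 ∧ c7 < c1) := by
    clear * - hrow17 hC1 hC6 hC7; omega
  clear hrow35 hrow26 hrow17
  have lo : p₁ ≤ 2 ∨ c1 ≤ 2 ∨ c2 ≤ 2 ∨ c3 ≤ 2 ∨ c4 ≤ 2 ∨ c5 ≤ 2 ∨ c6 ≤ 2 ∨ c7 ≤ 2 := by
    clear * - hlo hC1 hC2 hC3 hC4 hC5 hC6; omega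
  have hi : m - r₄ - 1 ≤ 2 ∨ c7 + (m - r₄ - 1) ≤ c1 + 1 ∨ c7 + (m - r₄ - 1) ≤ c2 + 1 ∨
      c7 + (m - r₄ - 1) ≤ c3 + 1 ∨ c7 + (m - r₄ - 1) ≤ c4 + 1 ∨ c7 + (m - r₄ - 1) ≤ c5 + 1 ∨
      c7 + (m - r₄ - 1) ≤ c6 + 1 ∨ c7 + (m - r₄ - 1) ≤ p₁ + 1 := by
    clear * - hhi hM hC1 hC2 hC3 hC4 hC5 hC6 hC7 hr4m; omega
  clear hlo hhi
  have e1 : c1 = p₁ + (p₂ - p₁ - 1) ∨ c1 + (p₂ - p₁ - 1) = p₁ := by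
    clear * - E1 hC1 h12; omega
  have e2 : c2 = c1 + (p₃ - p₂ - 1) ∨ c2 + (p₃ - p₂ - 1) = c1 := by
    clear * - E2 hC1 hC2 h23; omega
  have e3 : c3 = c2 + (p₄ - p₃ - 1) ∨ c3 + (p₄ - p₃ - 1) = c2 := by
    clear * - E3 hC2 hC3 h34; omega
  have e4 : c4 = c3 + (r₁ - p₄ - 1) ∨ c4 + (r₁ - p₄ - 1) = c3 := by
    clear * - E4 hC3 hC4 ht4; omega
  have e5 : c5 = c4 + (r₂ - r₁ - 1) ∨ c5 + (r₂ - r₁ - 1) = c4 := by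
    clear * - E5 hC4 hC5 hr12; omega
  have e6 : c6 = c5 + (r₃ - r₂ - 1) ∨ c6 + (r₃ - r₂ - 1) = c5 := by
    clear * - E6 hC5 hC6 hr23; omega
  have e7 : c7 = c6 + (r₄ - r₃ - 1) ∨ c7 + (r₄ - r₃ - 1) = c6 := by
    clear * - E7 hC6 hC7 hr34; omega
  clear E1 E2 E3 E4 E5 E6 E7
  have hp1' : (p₂ - p₁ - 1) % 2 = 1 := by clear * - e1 hpodd hq2 hC1 h12; omega
  have hp2' : (p₃ - p₂ - 1) % 2 = 1 := by clear * - e2 hq2 hq3 hC1 hC2 h23; omega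
  have hp3' : (p₄ - p₃ - 1) % 2 = 1 := by clear * - e3 hq3 hq4 hC2 hC3 h34; omega
  have hp4' : (r₁ - p₄ - 1) % 2 = 0 := by clear * - e4 hq4 hq5 hC3 hC4 ht4; omega
  have hp5' : (r₂ - r₁ - 1) % 2 = 1 := by clear * - e5 hq5 hq6 hC4 hC5 hr12; omega
  have hp6' : (r₃ - r₂ - 1) % 2 = 1 := by clear * - e6 hq6 hq7 hC5 hC6 hr23; omega
  have hp7' : (r₄ - r₃ - 1) % 2 = 1 := by clear * - e7 hq7 hq8 hC6 hC7 hr34; omega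
  have hh1 : 1 ≤ p₂ - p₁ - 1 := by clear * - hg1 e1 hpodd hq2 hC1 h12; omega
  have hh2 : 1 ≤ p₃ - p₂ - 1 := by clear * - hg2 e2 hq2 hq3 hC1 hC2 h23; omega
  have hh3 : 1 ≤ p₄ - p₃ - 1 := by clear * - hg3 e3 hq3 hq4 hC2 hC3 h34; omega
  have hh4 : 1 ≤ r₁ - p₄ - 1 := by clear * - hg4 e4 hq4 hq5 hC3 hC4 ht4; omega
  have hh5 : 1 ≤ r₂ - r₁ - 1 := by clear * - e5 hq5 hq6 hC4 hC5 hr12; omega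
  have hh6 : 1 ≤ r₃ - r₂ - 1 := by clear * - e6 hq6 hq7 hC5 hC6 hr23; omega
  have hh7 : 1 ≤ r₄ - r₃ - 1 := by clear * - e7 hq7 hq8 hC6 hC7 hr34; omega
  have hX1' : c1 ≤ c7 + (m - r₄ - 1) := by clear * - hX1 hM hC1 hC7 hr4m; omega
  have hX2' : c2 ≤ c7 + (m - r₄ - 1) := by clear * - hX2 hM hC2 hC7 hr4m; omega
  have hX3' : c3 ≤ c7 + (m - r₄ - 1) := by clear * - hX3 hM hC3 hC7 hr4m; omega
  have hX4' : c4 ≤ c7 + (m - r₄ - 1) := by clear * - hX4 hM hC4 hC7 hr4m; omega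
  have hX5' : c5 ≤ c7 + (m - r₄ - 1) := by clear * - hX5 hM hC5 hC7 hr4m; omega
  have hX6' : c6 ≤ c7 + (m - r₄ - 1) := by clear * - hX6 hM hC6 hC7 hr4m; omega
  exact
    { hk := hk, hlen := by clear * - hm h12 h23 h34 ht4 hr12 hr23 hr34 hr4m; omega,
      hvis := by clear * - hs_eq hr4m; omega, hf := by clear * - hs_eq hpodd hr4m; omega, hpp := hpodd,
      hp1 := hp1', hp2 := hp2', hp3 := hp3', hp4 := hp4', hp5 := hp5', hp6 := hp6', hp7 := hp7', hh1 := hh1,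
      hh2 := hh2, hh3 := hh3, hh4 := hh4, hh5 := hh5, hh6 := hh6, hh7 := hh7, e1 := e1, e2 := e2, e3 := e3,
      e4 := e4, e5 := e5, e6 := e6, e7 := e7, row35 := row35, row26 := row26, row17 := row17,
      wall := by clear * - hwall hC7; omega, x1 := by clear * - hx2 hC1; omega, x2 := by clear * - hx3 hC2; omega,
      x3 := by clear * - hx4 hC3; omega, x4 := by clear * - hx5 hC4; omega, x5 := by clear * - hx6 hC5; omega,
      x6 := by clear * - hx7 hC6; omega, X1 := hX1', X2 := hX2', X3 := hX3', X4 := hX4', X5 := hX5', X6 := hX6',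
      irrlo := lo, irrhi := hi }

/-- **The constraint system of a `D D D U D U U U` block at slack four.** For an irreducible positive wall bridge of
length `6k + 4` (`k ≥ 2`) with `k` wall visits and vertical steps in the order `D D D U D U U U` (down times
`p₁ < p₂ < p₃ < p₄`, up times `r₁ < r₂ < r₃ < r₄`), the columns `c₁ … c₇` of the vertical steps 2, …, 8 are natural
numbers and, with `p = p₁`, `f = m − r₄ − 1` and the run lengths `hⱼ = tⱼ₊₁ − tⱼ − 1`, satisfy `Ddduduuu4Hyp`
(`…SlackFourFourDownHyp`): LEN, VIS (`r₄ + 2k + 1 = m + p₁`), PAR (brick-wall parities of the step columns and of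
`X`), positive runs, SIGNS (the runs of `ddduduuu4_runs`), ROWS (runs 3, 5 on row `−3`; runs 2, 4 on row `−2`; runs
2, 6 on row `−2`; runs 4, 6 on row `−2`; runs 1, 7 on row `−1`: `row_runs_apart` + self-avoidance), WALL
(`resurface_right_of_initial_run`), XRNG (bridge), IRR (`four_down_shield_low/high`). Four-down analogue of
`ddduuu4_families` (`…SlackFourThreeDownSystems`) up to the table. OURS.
[cite: MadrasSlade1993, §4.2, Definition 4.2.1 (p. 90), remark before (4.2.21) (p. 94)]
[cite: EntingJensen2009, §7.4.2, Fig. 7.10] -/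
theorem ddduduuu4_hyp {k m : ℕ}
    (hk : 2 ≤ k) (hm : m = 6 * k + 4) (hω : ω ∈ ipwb m) (hv : visits m ω = k) {p₁ p₂ p₃ p₄ r₁ r₂ r₃ r₄ : ℕ}
    (hD : stepsD m ω = {p₁, p₂, p₃, p₄}) (hU : stepsU m ω = {r₁, r₂, r₃, r₄}) (h12 : p₁ < p₂) (h23 : p₂ < p₃)
    (h34 : p₃ < p₄) (hr12 : r₁ < r₂) (hr23 : r₂ < r₃) (hr34 : r₃ < r₄) (ht3 : p₃ < r₁) (ht4 : r₁ < p₄) (ht5 : p₄ < r₂)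
    (hp1 : 1 ≤ p₁) (hR0 : ∀ i, i ≤ p₁ → ω i 0 = i ∧ ω i 1 = 0) (hP1x : ω (p₁ + 1) 0 = p₁) (hP1y : ω (p₁ + 1) 1 = -1)
    (hhor : ∀ i, i < m → i ∉ stepsD m ω → i ∉ stepsU m ω → ω (i + 1) 1 = ω i 1 ∧
        (ω (i + 1) 0 = ω i 0 + 1 ∨ ω (i + 1) 0 = ω i 0 - 1)) :
    ∃ c1 c2 c3 c4 c5 c6 c7 : ℕ, (c1 : ℤ) = ω p₂ 0 ∧ (c2 : ℤ) = ω p₃ 0 ∧ (c3 : ℤ) = ω r₁ 0 ∧ (c4 : ℤ) = ω p₄ 0 ∧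
      (c5 : ℤ) = ω r₂ 0 ∧ (c6 : ℤ) = ω r₃ 0 ∧ (c7 : ℤ) = ω r₄ 0 ∧ r₄ + 2 * k + 1 = m + p₁ ∧
      Ddduduuu4Hyp k p₁ (m - r₄ - 1) (p₂ - p₁ - 1) (p₃ - p₂ - 1) (r₁ - p₃ - 1) (p₄ - r₁ - 1) (r₂ - p₄ - 1)
          (r₃ - r₂ - 1) (r₄ - r₃ - 1) c1 c2 c3 c4 c5 c6 c7 := by
  classical
  obtain ⟨hpw, hn1, hirr⟩ := mem_ipwb.1 hω
  obtain ⟨hw, hbr⟩ := mem_pwb.1 hpw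
  obtain ⟨ha, -⟩ := mem_wbr.1 hw
  obtain ⟨hh, -, -⟩ := mem_archs.1 ha
  obtain ⟨hs, hhp⟩ := mem_hpw.1 hh
  obtain ⟨h0, -, hbw, hinj⟩ := mem_saws_iff.1 hs
  have hX0 : ω 0 0 = 0 := by rw [h0]; rfl
  have hb' : ∀ i, 1 ≤ i → i ≤ m → 0 < ω i 0 ∧ ω i 0 ≤ ω m 0 := fun i h1 h2 => by
    have := hbr i h1 h2; rwa [hX0] at this
  have hmem : ∀ i, i ≤ m → i ∈ {i | i ≤ m} := fun i hi => hi
  have hmD : ∀ i, i ∈ stepsD m ω ↔ i = p₁ ∨ i = p₂ ∨ i = p₃ ∨ i = p₄ := fun i => by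
    rw [hD]; simp only [Finset.mem_insert, Finset.mem_singleton]
  obtain ⟨-, -, -, hppar1⟩ := of_mem_stepsD_coord hbw (i := p₁) ((hmD _).2 (by simp))
  have hpodd : p₁ % 2 = 1 := by rw [hP1x, hP1y] at hppar1; omega
  obtain ⟨e₁, e₂, e₃, e₄, e₅, e₆, e₇, he₁, he₂, he₃, he₄, he₅, he₆, he₇, hrun1, hrun2, hrun3, hrun4, hrun5,
      hrun6, hrun7, hR8, hs_eq, hN, hq2, hq3, hq4, hq5, hq6, hq7, hq8, hx2, hx3, hx4, hx5, hx6, hx7,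
      hg1, hg2, hg3, hg4, hg5, hr4m⟩ :=
    ddduduuu4_runs hm hω hv hD hU h12 h23 h34 hr12 hr23 hr34 ht3 ht4 ht5 hp1 hR0 hP1x hP1y hhor
  -- the end columns of the seven body runs and of the final run; `X` is even
  have hb1 := (hrun1 p₂ (Nat.succ_le_of_lt h12) le_rfl).1
  have hb2 := (hrun2 p₃ (Nat.succ_le_of_lt h23) le_rfl).1
  have hb3 := (hrun3 r₁ (Nat.succ_le_of_lt ht3) le_rfl).1
  have hb4 := (hrun4 p₄ (Nat.succ_le_of_lt ht4) le_rfl).1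
  have hb5 := (hrun5 r₂ (Nat.succ_le_of_lt ht5) le_rfl).1
  have hb6 := (hrun6 r₃ (Nat.succ_le_of_lt hr23) le_rfl).1
  have hb7 := (hrun7 r₄ (Nat.succ_le_of_lt hr34) le_rfl).1
  have hM := (hR8 m (Nat.succ_le_of_lt hr4m) le_rfl).1
  -- WALL: the resurfacing column lies right of the initial run
  have hwall : (p₁ : ℤ) + 1 ≤ ω r₄ 0 :=
    resurface_right_of_initial_run hinj (fun i h1 h2 => (hb' i h1 h2).1)
        (by clear * - h12 h23 ht3 ht4 ht5 hr23 hr34; omega) hr4m hR0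
      hR8
  -- ROWS: the runs sharing a row are separated (self-avoidance)
  have hrow35 := row_runs_apart (a := ω p₃ 0) (c := ω p₄ 0) he₃ he₅ (Nat.succ_le_of_lt ht3)
    (Nat.succ_le_of_lt ht5) (fun i h1 h2 => (hrun3 i h1 h2).1) (fun j h1 h2 => (hrun5 j h1 h2).1)
    (fun i j hi1 hi2 hj1 hj2 hx => by
      have := hinj (hmem i (by clear * - hi2 ht4 ht5 hr23 hr34 hr4m; omega))
          (hmem j (by clear * - hj2 ht5 hr23 hr34 hr4m; omega))
        (site_ext_d4s hx (by rw [(hrun3 i hi1 hi2).2, (hrun5 j hj1 hj2).2]))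
      clear * - this hi2 hj1 ht4
      omega)
  have hrow24 := row_runs_apart (a := ω p₂ 0) (c := ω r₁ 0) he₂ he₄ (Nat.succ_le_of_lt h23)
    (Nat.succ_le_of_lt ht4) (fun i h1 h2 => (hrun2 i h1 h2).1) (fun j h1 h2 => (hrun4 j h1 h2).1)
    (fun i j hi1 hi2 hj1 hj2 hx => by
      have := hinj (hmem i (by clear * - hi2 ht3 ht4 ht5 hr23 hr34 hr4m; omega))
          (hmem j (by clear * - hj2 ht4 ht5 hr23 hr34 hr4m; omega))
        (site_ext_d4s hx (by rw [(hrun2 i hi1 hi2).2, (hrun4 j hj1 hj2).2]))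
      clear * - this hi2 hj1 ht3
      omega)
  have hrow26 := row_runs_apart (a := ω p₂ 0) (c := ω r₂ 0) he₂ he₆ (Nat.succ_le_of_lt h23)
    (Nat.succ_le_of_lt hr23) (fun i h1 h2 => (hrun2 i h1 h2).1) (fun j h1 h2 => (hrun6 j h1 h2).1)
    (fun i j hi1 hi2 hj1 hj2 hx => by
      have := hinj (hmem i (by clear * - hi2 ht3 ht4 ht5 hr23 hr34 hr4m; omega))
          (hmem j (by clear * - hj2 hr23 hr34 hr4m; omega))
        (site_ext_d4s hx (by rw [(hrun2 i hi1 hi2).2, (hrun6 j hj1 hj2).2]))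
      clear * - this hi2 hj1 ht3 ht4 ht5
      omega)
  have hrow46 := row_runs_apart (a := ω r₁ 0) (c := ω r₂ 0) he₄ he₆ (Nat.succ_le_of_lt ht4)
    (Nat.succ_le_of_lt hr23) (fun i h1 h2 => (hrun4 i h1 h2).1) (fun j h1 h2 => (hrun6 j h1 h2).1)
    (fun i j hi1 hi2 hj1 hj2 hx => by
      have := hinj (hmem i (by clear * - hi2 ht5 hr23 hr34 hr4m; omega))
          (hmem j (by clear * - hj2 hr23 hr34 hr4m; omega))
        (site_ext_d4s hx (by rw [(hrun4 i hi1 hi2).2, (hrun6 j hj1 hj2).2]))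
      clear * - this hi2 hj1 ht5
      omega)
  have hrow17 := row_runs_apart (a := (p₁ : ℤ)) (c := ω r₃ 0) he₁ he₇ (Nat.succ_le_of_lt h12)
    (Nat.succ_le_of_lt hr34) (fun i h1 h2 => (hrun1 i h1 h2).1) (fun j h1 h2 => (hrun7 j h1 h2).1)
    (fun i j hi1 hi2 hj1 hj2 hx => by
      have := hinj (hmem i (by clear * - hi2 h23 ht3 ht4 ht5 hr23 hr34 hr4m; omega))
          (hmem j (by clear * - hj2 hr34 hr4m; omega))
        (site_ext_d4s hx (by rw [(hrun1 i hi1 hi2).2, (hrun7 j hj1 hj2).2]))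
      clear * - this hi2 hj1 h23 ht3 ht4 ht5 hr23
      omega)
  -- SIGNS, sign-free
  have E1 : ω p₂ 0 = p₁ + ((p₂ - p₁ - 1 : ℕ) : ℤ) ∨ ω p₂ 0 + ((p₂ - p₁ - 1 : ℕ) : ℤ) = p₁ := by
    clear * - he₁ hb1 h12; rcases he₁ with rfl | rfl <;> omega
  have E2 : ω p₃ 0 = ω p₂ 0 + ((p₃ - p₂ - 1 : ℕ) : ℤ) ∨ ω p₃ 0 + ((p₃ - p₂ - 1 : ℕ) : ℤ) = ω p₂ 0 := by
    clear * - he₂ hb2 h23; rcases he₂ with rfl | rfl <;> omega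
  have E3 : ω r₁ 0 = ω p₃ 0 + ((r₁ - p₃ - 1 : ℕ) : ℤ) ∨ ω r₁ 0 + ((r₁ - p₃ - 1 : ℕ) : ℤ) = ω p₃ 0 := by
    clear * - he₃ hb3 ht3; rcases he₃ with rfl | rfl <;> omega
  have E4 : ω p₄ 0 = ω r₁ 0 + ((p₄ - r₁ - 1 : ℕ) : ℤ) ∨ ω p₄ 0 + ((p₄ - r₁ - 1 : ℕ) : ℤ) = ω r₁ 0 := by
    clear * - he₄ hb4 ht4; rcases he₄ with rfl | rfl <;> omega
  have E5 : ω r₂ 0 = ω p₄ 0 + ((r₂ - p₄ - 1 : ℕ) : ℤ) ∨ ω r₂ 0 + ((r₂ - p₄ - 1 : ℕ) : ℤ) = ω p₄ 0 := by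
    clear * - he₅ hb5 ht5; rcases he₅ with rfl | rfl <;> omega
  have E6 : ω r₃ 0 = ω r₂ 0 + ((r₃ - r₂ - 1 : ℕ) : ℤ) ∨ ω r₃ 0 + ((r₃ - r₂ - 1 : ℕ) : ℤ) = ω r₂ 0 := by
    clear * - he₆ hb6 hr23; rcases he₆ with rfl | rfl <;> omega
  have E7 : ω r₄ 0 = ω r₃ 0 + ((r₄ - r₃ - 1 : ℕ) : ℤ) ∨ ω r₄ 0 + ((r₄ - r₃ - 1 : ℕ) : ℤ) = ω r₃ 0 := by
    clear * - he₇ hb7 hr34; rcases he₇ with rfl | rfl <;> omega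
  -- IRR: the two shields
  have hlo : p₁ ≤ 2 ∨ ω p₂ 0 ≤ 2 ∨ ω p₃ 0 ≤ 2 ∨ ω r₁ 0 ≤ 2 ∨ ω p₄ 0 ≤ 2 ∨ ω r₂ 0 ≤ 2 ∨ ω r₃ 0 ≤ 2 := by
    rcases Nat.lt_or_ge p₁ 3 with h | h
    · exact Or.inl (by clear * - h; omega)
    · exact Or.inr (four_down_shield_low hbr hirr hR0 he₁ he₂ he₃ he₄ he₅ he₆ he₇
        (fun i h1 h2 => (hrun1 i h1 h2).1) (fun i h1 h2 => (hrun2 i h1 h2).1) (fun i h1 h2 => (hrun3 i h1 h2).1)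
        (fun i h1 h2 => (hrun4 i h1 h2).1) (fun i h1 h2 => (hrun5 i h1 h2).1) (fun i h1 h2 => (hrun6 i h1 h2).1)
        (fun i h1 h2 => (hrun7 i h1 h2).1) hR8 h h12 h23 ht3 ht4 ht5 hr23 hr34 hr4m hwall)
  have hhi : m - r₄ - 1 ≤ 2 ∨ ω m 0 ≤ ω p₂ 0 + 1 ∨ ω m 0 ≤ ω p₃ 0 + 1 ∨ ω m 0 ≤ ω r₁ 0 + 1 ∨
      ω m 0 ≤ ω p₄ 0 + 1 ∨ ω m 0 ≤ ω r₂ 0 + 1 ∨ ω m 0 ≤ ω r₃ 0 + 1 := by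
    rcases Nat.lt_or_ge (m - r₄ - 1) 3 with h | h
    · exact Or.inl (by clear * - h; omega)
    · exact Or.inr (four_down_shield_high hbr hirr hR0 he₁ he₂ he₃ he₄ he₅ he₆ he₇
        (fun i h1 h2 => (hrun1 i h1 h2).1) (fun i h1 h2 => (hrun2 i h1 h2).1) (fun i h1 h2 => (hrun3 i h1 h2).1)
        (fun i h1 h2 => (hrun4 i h1 h2).1) (fun i h1 h2 => (hrun5 i h1 h2).1) (fun i h1 h2 => (hrun6 i h1 h2).1)
        (fun i h1 h2 => (hrun7 i h1 h2).1) hR8 (by clear * - h hr4m; omega) (by clear * - hm; omega) h12 h23 ht3 ht4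
        ht5 hr23 hr34 hwall)
  -- XRNG: the bridge range
  have hX1 := (hb' p₂ (by clear * - hp1 h12; omega) (by clear * - h23 ht3 ht4 ht5 hr23 hr34 hr4m; omega)).2
  have hX2 := (hb' p₃ (by clear * - hp1 h12 h23; omega) (by clear * - ht3 ht4 ht5 hr23 hr34 hr4m; omega)).2
  have hX3 := (hb' r₁ (by clear * - hp1 h12 h23 ht3; omega) (by clear * - ht4 ht5 hr23 hr34 hr4m; omega)).2
  have hX4 := (hb' p₄ (by clear * - hp1 h12 h23 ht3 ht4; omega) (by clear * - ht5 hr23 hr34 hr4m; omega)).2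
  have hX5 := (hb' r₂ (by clear * - hp1 h12 h23 ht3 ht4 ht5; omega) (by clear * - hr23 hr34 hr4m; omega)).2
  have hX6 := (hb' r₃ (by clear * - hp1 h12 h23 ht3 ht4 ht5 hr23; omega) (by clear * - hr34 hr4m; omega)).2
  -- integer columns, then the fields of the system one by one (each `omega` sees few disjunctions)
  obtain ⟨c1, hC1⟩ := Int.eq_ofNat_of_zero_le hx2.le
  obtain ⟨c2, hC2⟩ := Int.eq_ofNat_of_zero_le hx3.le
  obtain ⟨c3, hC3⟩ := Int.eq_ofNat_of_zero_le hx4.le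
  obtain ⟨c4, hC4⟩ := Int.eq_ofNat_of_zero_le hx5.le
  obtain ⟨c5, hC5⟩ := Int.eq_ofNat_of_zero_le hx6.le
  obtain ⟨c6, hC6⟩ := Int.eq_ofNat_of_zero_le hx7.le
  obtain ⟨c7, hC7⟩ := Int.eq_ofNat_of_zero_le (show (0 : ℤ) ≤ ω r₄ 0 by clear * - hwall; omega)
  clear hrun1 hrun2 hrun3 hrun4 hrun5 hrun6 hrun7 hR8 hhor hmD hR0 hb' hbr hirr he₁ he₂ he₃ he₄ he₅ he₆ he₇ hppar1
    hP1x hP1y hmem hinj hbw hb1 hb2 hb3 hb4 hb5 hb6 hb7 hpw hw ha hh hs hhp h0 hX0 hn1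
  refine ⟨c1, c2, c3, c4, c5, c6, c7, hC1.symm, hC2.symm, hC3.symm, hC4.symm, hC5.symm, hC6.symm, hC7.symm, hs_eq, ?_⟩
  have row35 : (c2 < c4 ∧ c2 < c5 ∧ c3 < c4 ∧ c3 < c5) ∨ (c4 < c2 ∧ c5 < c2 ∧ c4 < c3 ∧ c5 < c3) := by
    clear * - hrow35 hC2 hC3 hC4 hC5; omega
  have row24 : (c1 < c3 ∧ c1 < c4 ∧ c2 < c3 ∧ c2 < c4) ∨ (c3 < c1 ∧ c4 < c1 ∧ c3 < c2 ∧ c4 < c2) := by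
    clear * - hrow24 hC1 hC2 hC3 hC4; omega
  have row26 : (c1 < c5 ∧ c1 < c6 ∧ c2 < c5 ∧ c2 < c6) ∨ (c5 < c1 ∧ c6 < c1 ∧ c5 < c2 ∧ c6 < c2) := by
    clear * - hrow26 hC1 hC2 hC5 hC6; omega
  have row46 : (c3 < c5 ∧ c3 < c6 ∧ c4 < c5 ∧ c4 < c6) ∨ (c5 < c3 ∧ c6 < c3 ∧ c5 < c4 ∧ c6 < c4) := by
    clear * - hrow46 hC3 hC4 hC5 hC6; omega
  have row17 : (p₁ < c6 ∧ p₁ < c7 ∧ c1 < c6 ∧ c1 < c7) ∨ (c6 < p₁ ∧ c7 < p₁ ∧ c6 < c1 ∧ c7 < c1) := by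
    clear * - hrow17 hC1 hC6 hC7; omega
  clear hrow35 hrow24 hrow26 hrow46 hrow17
  have lo : p₁ ≤ 2 ∨ c1 ≤ 2 ∨ c2 ≤ 2 ∨ c3 ≤ 2 ∨ c4 ≤ 2 ∨ c5 ≤ 2 ∨ c6 ≤ 2 ∨ c7 ≤ 2 := by
    clear * - hlo hC1 hC2 hC3 hC4 hC5 hC6; omega
  have hi : m - r₄ - 1 ≤ 2 ∨ c7 + (m - r₄ - 1) ≤ c1 + 1 ∨ c7 + (m - r₄ - 1) ≤ c2 + 1 ∨
      c7 + (m - r₄ - 1) ≤ c3 + 1 ∨ c7 + (m - r₄ - 1) ≤ c4 + 1 ∨ c7 + (m - r₄ - 1) ≤ c5 + 1 ∨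
      c7 + (m - r₄ - 1) ≤ c6 + 1 ∨ c7 + (m - r₄ - 1) ≤ p₁ + 1 := by
    clear * - hhi hM hC1 hC2 hC3 hC4 hC5 hC6 hC7 hr4m; omega
  clear hlo hhi
  have e1 : c1 = p₁ + (p₂ - p₁ - 1) ∨ c1 + (p₂ - p₁ - 1) = p₁ := by
    clear * - E1 hC1 h12; omega
  have e2 : c2 = c1 + (p₃ - p₂ - 1) ∨ c2 + (p₃ - p₂ - 1) = c1 := by
    clear * - E2 hC1 hC2 h23; omega
  have e3 : c3 = c2 + (r₁ - p₃ - 1) ∨ c3 + (r₁ - p₃ - 1) = c2 := by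
    clear * - E3 hC2 hC3 ht3; omega
  have e4 : c4 = c3 + (p₄ - r₁ - 1) ∨ c4 + (p₄ - r₁ - 1) = c3 := by
    clear * - E4 hC3 hC4 ht4; omega
  have e5 : c5 = c4 + (r₂ - p₄ - 1) ∨ c5 + (r₂ - p₄ - 1) = c4 := by
    clear * - E5 hC4 hC5 ht5; omega
  have e6 : c6 = c5 + (r₃ - r₂ - 1) ∨ c6 + (r₃ - r₂ - 1) = c5 := by
    clear * - E6 hC5 hC6 hr23; omega
  have e7 : c7 = c6 + (r₄ - r₃ - 1) ∨ c7 + (r₄ - r₃ - 1) = c6 := by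
    clear * - E7 hC6 hC7 hr34; omega
  clear E1 E2 E3 E4 E5 E6 E7
  have hp1' : (p₂ - p₁ - 1) % 2 = 1 := by clear * - e1 hpodd hq2 hC1 h12; omega
  have hp2' : (p₃ - p₂ - 1) % 2 = 1 := by clear * - e2 hq2 hq3 hC1 hC2 h23; omega
  have hp3' : (r₁ - p₃ - 1) % 2 = 0 := by clear * - e3 hq3 hq4 hC2 hC3 ht3; omega
  have hp4' : (p₄ - r₁ - 1) % 2 = 0 := by clear * - e4 hq4 hq5 hC3 hC4 ht4; omega
  have hp5' : (r₂ - p₄ - 1) % 2 = 0 := by clear * - e5 hq5 hq6 hC4 hC5 ht5; omega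
  have hp6' : (r₃ - r₂ - 1) % 2 = 1 := by clear * - e6 hq6 hq7 hC5 hC6 hr23; omega
  have hp7' : (r₄ - r₃ - 1) % 2 = 1 := by clear * - e7 hq7 hq8 hC6 hC7 hr34; omega
  have hh1 : 1 ≤ p₂ - p₁ - 1 := by clear * - hg1 e1 hpodd hq2 hC1 h12; omega
  have hh2 : 1 ≤ p₃ - p₂ - 1 := by clear * - hg2 e2 hq2 hq3 hC1 hC2 h23; omega
  have hh3 : 1 ≤ r₁ - p₃ - 1 := by clear * - hg3 e3 hq3 hq4 hC2 hC3 ht3; omega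
  have hh4 : 1 ≤ p₄ - r₁ - 1 := by clear * - hg4 e4 hq4 hq5 hC3 hC4 ht4; omega
  have hh5 : 1 ≤ r₂ - p₄ - 1 := by clear * - hg5 e5 hq5 hq6 hC4 hC5 ht5; omega
  have hh6 : 1 ≤ r₃ - r₂ - 1 := by clear * - e6 hq6 hq7 hC5 hC6 hr23; omega
  have hh7 : 1 ≤ r₄ - r₃ - 1 := by clear * - e7 hq7 hq8 hC6 hC7 hr34; omega
  have hX1' : c1 ≤ c7 + (m - r₄ - 1) := by clear * - hX1 hM hC1 hC7 hr4m; omega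
  have hX2' : c2 ≤ c7 + (m - r₄ - 1) := by clear * - hX2 hM hC2 hC7 hr4m; omega
  have hX3' : c3 ≤ c7 + (m - r₄ - 1) := by clear * - hX3 hM hC3 hC7 hr4m; omega
  have hX4' : c4 ≤ c7 + (m - r₄ - 1) := by clear * - hX4 hM hC4 hC7 hr4m; omega
  have hX5' : c5 ≤ c7 + (m - r₄ - 1) := by clear * - hX5 hM hC5 hC7 hr4m; omega
  have hX6' : c6 ≤ c7 + (m - r₄ - 1) := by clear * - hX6 hM hC6 hC7 hr4m; omega
  exact
    { hk := hk, hlen := by clear * - hm h12 h23 ht3 ht4 ht5 hr23 hr34 hr4m; omega,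
      hvis := by clear * - hs_eq hr4m; omega, hf := by clear * - hs_eq hpodd hr4m; omega, hpp := hpodd,
      hp1 := hp1', hp2 := hp2', hp3 := hp3', hp4 := hp4', hp5 := hp5', hp6 := hp6', hp7 := hp7', hh1 := hh1,
      hh2 := hh2, hh3 := hh3, hh4 := hh4, hh5 := hh5, hh6 := hh6, hh7 := hh7, e1 := e1, e2 := e2, e3 := e3,
      e4 := e4, e5 := e5, e6 := e6, e7 := e7, row35 := row35, row24 := row24, row26 := row26, row46 := row46,
      row17 := row17, wall := by clear * - hwall hC7; omega, x1 := by clear * - hx2 hC1; omega,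
      x2 := by clear * - hx3 hC2; omega, x3 := by clear * - hx4 hC3; omega, x4 := by clear * - hx5 hC4; omega,
      x5 := by clear * - hx6 hC5; omega, x6 := by clear * - hx7 hC6; omega, X1 := hX1', X2 := hX2', X3 := hX3',
      X4 := hX4', X5 := hX5', X6 := hX6', irrlo := lo, irrhi := hi }

/-- **The constraint system of a `D D D U U D U U` block at slack four.** For an irreducible positive wall bridge of
length `6k + 4` (`k ≥ 2`) with `k` wall visits and vertical steps in the order `D D D U U D U U` (down times
`p₁ < p₂ < p₃ < p₄`, up times `r₁ < r₂ < r₃ < r₄`), the columns `c₁ … c₇` of the vertical steps 2, …, 8 are natural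
numbers and, with `p = p₁`, `f = m − r₄ − 1` and the run lengths `hⱼ = tⱼ₊₁ − tⱼ − 1`, satisfy `Ddduuduu4Hyp`
(`…SlackFourFourDownHyp`): LEN, VIS (`r₄ + 2k + 1 = m + p₁`), PAR (brick-wall parities of the step columns and of
`X`), positive runs, SIGNS (the runs of `ddduuduu4_runs`), ROWS (runs 2, 4 on row `−2`; runs 2, 6 on row `−2`; runs
4, 6 on row `−2`; runs 1, 5 on row `−1`; runs 1, 7 on row `−1`; runs 5, 7 on row `−1`: `row_runs_apart` +
self-avoidance), WALL (`resurface_right_of_initial_run`), XRNG (bridge), IRR (`four_down_shield_low/high`).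
Four-down analogue of `ddduuu4_families` (`…SlackFourThreeDownSystems`) up to the table. OURS.
[cite: MadrasSlade1993, §4.2, Definition 4.2.1 (p. 90), remark before (4.2.21) (p. 94)]
[cite: EntingJensen2009, §7.4.2, Fig. 7.10] -/
theorem ddduuduu4_hyp {k m : ℕ}
    (hk : 2 ≤ k) (hm : m = 6 * k + 4) (hω : ω ∈ ipwb m) (hv : visits m ω = k) {p₁ p₂ p₃ p₄ r₁ r₂ r₃ r₄ : ℕ}
    (hD : stepsD m ω = {p₁, p₂, p₃, p₄}) (hU : stepsU m ω = {r₁, r₂, r₃, r₄}) (h12 : p₁ < p₂) (h23 : p₂ < p₃)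
    (h34 : p₃ < p₄) (hr12 : r₁ < r₂) (hr23 : r₂ < r₃) (hr34 : r₃ < r₄) (ht3 : p₃ < r₁) (ht5 : r₂ < p₄) (ht6 : p₄ < r₃)
    (hp1 : 1 ≤ p₁) (hR0 : ∀ i, i ≤ p₁ → ω i 0 = i ∧ ω i 1 = 0) (hP1x : ω (p₁ + 1) 0 = p₁) (hP1y : ω (p₁ + 1) 1 = -1)
    (hhor : ∀ i, i < m → i ∉ stepsD m ω → i ∉ stepsU m ω → ω (i + 1) 1 = ω i 1 ∧
        (ω (i + 1) 0 = ω i 0 + 1 ∨ ω (i + 1) 0 = ω i 0 - 1)) :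
    ∃ c1 c2 c3 c4 c5 c6 c7 : ℕ, (c1 : ℤ) = ω p₂ 0 ∧ (c2 : ℤ) = ω p₃ 0 ∧ (c3 : ℤ) = ω r₁ 0 ∧ (c4 : ℤ) = ω r₂ 0 ∧
      (c5 : ℤ) = ω p₄ 0 ∧ (c6 : ℤ) = ω r₃ 0 ∧ (c7 : ℤ) = ω r₄ 0 ∧ r₄ + 2 * k + 1 = m + p₁ ∧
      Ddduuduu4Hyp k p₁ (m - r₄ - 1) (p₂ - p₁ - 1) (p₃ - p₂ - 1) (r₁ - p₃ - 1) (r₂ - r₁ - 1) (p₄ - r₂ - 1)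
          (r₃ - p₄ - 1) (r₄ - r₃ - 1) c1 c2 c3 c4 c5 c6 c7 := by
  classical
  obtain ⟨hpw, hn1, hirr⟩ := mem_ipwb.1 hω
  obtain ⟨hw, hbr⟩ := mem_pwb.1 hpw
  obtain ⟨ha, -⟩ := mem_wbr.1 hw
  obtain ⟨hh, -, -⟩ := mem_archs.1 ha
  obtain ⟨hs, hhp⟩ := mem_hpw.1 hh
  obtain ⟨h0, -, hbw, hinj⟩ := mem_saws_iff.1 hs
  have hX0 : ω 0 0 = 0 := by rw [h0]; rfl
  have hb' : ∀ i, 1 ≤ i → i ≤ m → 0 < ω i 0 ∧ ω i 0 ≤ ω m 0 := fun i h1 h2 => by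
    have := hbr i h1 h2; rwa [hX0] at this
  have hmem : ∀ i, i ≤ m → i ∈ {i | i ≤ m} := fun i hi => hi
  have hmD : ∀ i, i ∈ stepsD m ω ↔ i = p₁ ∨ i = p₂ ∨ i = p₃ ∨ i = p₄ := fun i => by
    rw [hD]; simp only [Finset.mem_insert, Finset.mem_singleton]
  obtain ⟨-, -, -, hppar1⟩ := of_mem_stepsD_coord hbw (i := p₁) ((hmD _).2 (by simp))
  have hpodd : p₁ % 2 = 1 := by rw [hP1x, hP1y] at hppar1; omega
  obtain ⟨e₁, e₂, e₃, e₄, e₅, e₆, e₇, he₁, he₂, he₃, he₄, he₅, he₆, he₇, hrun1, hrun2, hrun3, hrun4, hrun5,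
      hrun6, hrun7, hR8, hs_eq, hN, hq2, hq3, hq4, hq5, hq6, hq7, hq8, hx2, hx3, hx4, hx5, hx6, hx7,
      hg1, hg2, hg3, hg5, hg6, hr4m⟩ :=
    ddduuduu4_runs hm hω hv hD hU h12 h23 h34 hr12 hr23 hr34 ht3 ht5 ht6 hp1 hR0 hP1x hP1y hhor
  -- the end columns of the seven body runs and of the final run; `X` is even
  have hb1 := (hrun1 p₂ (Nat.succ_le_of_lt h12) le_rfl).1
  have hb2 := (hrun2 p₃ (Nat.succ_le_of_lt h23) le_rfl).1
  have hb3 := (hrun3 r₁ (Nat.succ_le_of_lt ht3) le_rfl).1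
  have hb4 := (hrun4 r₂ (Nat.succ_le_of_lt hr12) le_rfl).1
  have hb5 := (hrun5 p₄ (Nat.succ_le_of_lt ht5) le_rfl).1
  have hb6 := (hrun6 r₃ (Nat.succ_le_of_lt ht6) le_rfl).1
  have hb7 := (hrun7 r₄ (Nat.succ_le_of_lt hr34) le_rfl).1
  have hM := (hR8 m (Nat.succ_le_of_lt hr4m) le_rfl).1
  -- WALL: the resurfacing column lies right of the initial run
  have hwall : (p₁ : ℤ) + 1 ≤ ω r₄ 0 :=
    resurface_right_of_initial_run hinj (fun i h1 h2 => (hb' i h1 h2).1)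
        (by clear * - h12 h23 ht3 hr12 ht5 ht6 hr34; omega) hr4m hR0
      hR8
  -- ROWS: the runs sharing a row are separated (self-avoidance)
  have hrow24 := row_runs_apart (a := ω p₂ 0) (c := ω r₁ 0) he₂ he₄ (Nat.succ_le_of_lt h23)
    (Nat.succ_le_of_lt hr12) (fun i h1 h2 => (hrun2 i h1 h2).1) (fun j h1 h2 => (hrun4 j h1 h2).1)
    (fun i j hi1 hi2 hj1 hj2 hx => by
      have := hinj (hmem i (by clear * - hi2 ht3 hr12 ht5 ht6 hr34 hr4m; omega))
          (hmem j (by clear * - hj2 hr12 ht5 ht6 hr34 hr4m; omega))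
        (site_ext_d4s hx (by rw [(hrun2 i hi1 hi2).2, (hrun4 j hj1 hj2).2]))
      clear * - this hi2 hj1 ht3
      omega)
  have hrow26 := row_runs_apart (a := ω p₂ 0) (c := ω p₄ 0) he₂ he₆ (Nat.succ_le_of_lt h23)
    (Nat.succ_le_of_lt ht6) (fun i h1 h2 => (hrun2 i h1 h2).1) (fun j h1 h2 => (hrun6 j h1 h2).1)
    (fun i j hi1 hi2 hj1 hj2 hx => by
      have := hinj (hmem i (by clear * - hi2 ht3 hr12 ht5 ht6 hr34 hr4m; omega))
          (hmem j (by clear * - hj2 ht6 hr34 hr4m; omega))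
        (site_ext_d4s hx (by rw [(hrun2 i hi1 hi2).2, (hrun6 j hj1 hj2).2]))
      clear * - this hi2 hj1 ht3 hr12 ht5
      omega)
  have hrow46 := row_runs_apart (a := ω r₁ 0) (c := ω p₄ 0) he₄ he₆ (Nat.succ_le_of_lt hr12)
    (Nat.succ_le_of_lt ht6) (fun i h1 h2 => (hrun4 i h1 h2).1) (fun j h1 h2 => (hrun6 j h1 h2).1)
    (fun i j hi1 hi2 hj1 hj2 hx => by
      have := hinj (hmem i (by clear * - hi2 ht5 ht6 hr34 hr4m; omega))
          (hmem j (by clear * - hj2 ht6 hr34 hr4m; omega))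
        (site_ext_d4s hx (by rw [(hrun4 i hi1 hi2).2, (hrun6 j hj1 hj2).2]))
      clear * - this hi2 hj1 ht5
      omega)
  have hrow15 := row_runs_apart (a := (p₁ : ℤ)) (c := ω r₂ 0) he₁ he₅ (Nat.succ_le_of_lt h12)
    (Nat.succ_le_of_lt ht5) (fun i h1 h2 => (hrun1 i h1 h2).1) (fun j h1 h2 => (hrun5 j h1 h2).1)
    (fun i j hi1 hi2 hj1 hj2 hx => by
      have := hinj (hmem i (by clear * - hi2 h23 ht3 hr12 ht5 ht6 hr34 hr4m; omega))
          (hmem j (by clear * - hj2 ht5 ht6 hr34 hr4m; omega))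
        (site_ext_d4s hx (by rw [(hrun1 i hi1 hi2).2, (hrun5 j hj1 hj2).2]))
      clear * - this hi2 hj1 h23 ht3 hr12
      omega)
  have hrow17 := row_runs_apart (a := (p₁ : ℤ)) (c := ω r₃ 0) he₁ he₇ (Nat.succ_le_of_lt h12)
    (Nat.succ_le_of_lt hr34) (fun i h1 h2 => (hrun1 i h1 h2).1) (fun j h1 h2 => (hrun7 j h1 h2).1)
    (fun i j hi1 hi2 hj1 hj2 hx => by
      have := hinj (hmem i (by clear * - hi2 h23 ht3 hr12 ht5 ht6 hr34 hr4m; omega))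
          (hmem j (by clear * - hj2 hr34 hr4m; omega))
        (site_ext_d4s hx (by rw [(hrun1 i hi1 hi2).2, (hrun7 j hj1 hj2).2]))
      clear * - this hi2 hj1 h23 ht3 hr12 ht5 ht6
      omega)
  have hrow57 := row_runs_apart (a := ω r₂ 0) (c := ω r₃ 0) he₅ he₇ (Nat.succ_le_of_lt ht5)
    (Nat.succ_le_of_lt hr34) (fun i h1 h2 => (hrun5 i h1 h2).1) (fun j h1 h2 => (hrun7 j h1 h2).1)
    (fun i j hi1 hi2 hj1 hj2 hx => by
      have := hinj (hmem i (by clear * - hi2 ht6 hr34 hr4m; omega)) (hmem j (by clear * - hj2 hr34 hr4m; omega))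
        (site_ext_d4s hx (by rw [(hrun5 i hi1 hi2).2, (hrun7 j hj1 hj2).2]))
      clear * - this hi2 hj1 ht6
      omega)
  -- SIGNS, sign-free
  have E1 : ω p₂ 0 = p₁ + ((p₂ - p₁ - 1 : ℕ) : ℤ) ∨ ω p₂ 0 + ((p₂ - p₁ - 1 : ℕ) : ℤ) = p₁ := by
    clear * - he₁ hb1 h12; rcases he₁ with rfl | rfl <;> omega
  have E2 : ω p₃ 0 = ω p₂ 0 + ((p₃ - p₂ - 1 : ℕ) : ℤ) ∨ ω p₃ 0 + ((p₃ - p₂ - 1 : ℕ) : ℤ) = ω p₂ 0 := by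
    clear * - he₂ hb2 h23; rcases he₂ with rfl | rfl <;> omega
  have E3 : ω r₁ 0 = ω p₃ 0 + ((r₁ - p₃ - 1 : ℕ) : ℤ) ∨ ω r₁ 0 + ((r₁ - p₃ - 1 : ℕ) : ℤ) = ω p₃ 0 := by
    clear * - he₃ hb3 ht3; rcases he₃ with rfl | rfl <;> omega
  have E4 : ω r₂ 0 = ω r₁ 0 + ((r₂ - r₁ - 1 : ℕ) : ℤ) ∨ ω r₂ 0 + ((r₂ - r₁ - 1 : ℕ) : ℤ) = ω r₁ 0 := by
    clear * - he₄ hb4 hr12; rcases he₄ with rfl | rfl <;> omega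
  have E5 : ω p₄ 0 = ω r₂ 0 + ((p₄ - r₂ - 1 : ℕ) : ℤ) ∨ ω p₄ 0 + ((p₄ - r₂ - 1 : ℕ) : ℤ) = ω r₂ 0 := by
    clear * - he₅ hb5 ht5; rcases he₅ with rfl | rfl <;> omega
  have E6 : ω r₃ 0 = ω p₄ 0 + ((r₃ - p₄ - 1 : ℕ) : ℤ) ∨ ω r₃ 0 + ((r₃ - p₄ - 1 : ℕ) : ℤ) = ω p₄ 0 := by
    clear * - he₆ hb6 ht6; rcases he₆ with rfl | rfl <;> omega
  have E7 : ω r₄ 0 = ω r₃ 0 + ((r₄ - r₃ - 1 : ℕ) : ℤ) ∨ ω r₄ 0 + ((r₄ - r₃ - 1 : ℕ) : ℤ) = ω r₃ 0 := by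
    clear * - he₇ hb7 hr34; rcases he₇ with rfl | rfl <;> omega
  -- IRR: the two shields
  have hlo : p₁ ≤ 2 ∨ ω p₂ 0 ≤ 2 ∨ ω p₃ 0 ≤ 2 ∨ ω r₁ 0 ≤ 2 ∨ ω r₂ 0 ≤ 2 ∨ ω p₄ 0 ≤ 2 ∨ ω r₃ 0 ≤ 2 := by
    rcases Nat.lt_or_ge p₁ 3 with h | h
    · exact Or.inl (by clear * - h; omega)
    · exact Or.inr (four_down_shield_low hbr hirr hR0 he₁ he₂ he₃ he₄ he₅ he₆ he₇
        (fun i h1 h2 => (hrun1 i h1 h2).1) (fun i h1 h2 => (hrun2 i h1 h2).1) (fun i h1 h2 => (hrun3 i h1 h2).1)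
        (fun i h1 h2 => (hrun4 i h1 h2).1) (fun i h1 h2 => (hrun5 i h1 h2).1) (fun i h1 h2 => (hrun6 i h1 h2).1)
        (fun i h1 h2 => (hrun7 i h1 h2).1) hR8 h h12 h23 ht3 hr12 ht5 ht6 hr34 hr4m hwall)
  have hhi : m - r₄ - 1 ≤ 2 ∨ ω m 0 ≤ ω p₂ 0 + 1 ∨ ω m 0 ≤ ω p₃ 0 + 1 ∨ ω m 0 ≤ ω r₁ 0 + 1 ∨
      ω m 0 ≤ ω r₂ 0 + 1 ∨ ω m 0 ≤ ω p₄ 0 + 1 ∨ ω m 0 ≤ ω r₃ 0 + 1 := by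
    rcases Nat.lt_or_ge (m - r₄ - 1) 3 with h | h
    · exact Or.inl (by clear * - h; omega)
    · exact Or.inr (four_down_shield_high hbr hirr hR0 he₁ he₂ he₃ he₄ he₅ he₆ he₇
        (fun i h1 h2 => (hrun1 i h1 h2).1) (fun i h1 h2 => (hrun2 i h1 h2).1) (fun i h1 h2 => (hrun3 i h1 h2).1)
        (fun i h1 h2 => (hrun4 i h1 h2).1) (fun i h1 h2 => (hrun5 i h1 h2).1) (fun i h1 h2 => (hrun6 i h1 h2).1)
        (fun i h1 h2 => (hrun7 i h1 h2).1) hR8 (by clear * - h hr4m; omega) (by clear * - hm; omega) h12 h23 ht3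
        hr12 ht5 ht6 hr34 hwall)
  -- XRNG: the bridge range
  have hX1 := (hb' p₂ (by clear * - hp1 h12; omega) (by clear * - h23 ht3 hr12 ht5 ht6 hr34 hr4m; omega)).2
  have hX2 := (hb' p₃ (by clear * - hp1 h12 h23; omega) (by clear * - ht3 hr12 ht5 ht6 hr34 hr4m; omega)).2
  have hX3 := (hb' r₁ (by clear * - hp1 h12 h23 ht3; omega) (by clear * - hr12 ht5 ht6 hr34 hr4m; omega)).2
  have hX4 := (hb' r₂ (by clear * - hp1 h12 h23 ht3 hr12; omega) (by clear * - ht5 ht6 hr34 hr4m; omega)).2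
  have hX5 := (hb' p₄ (by clear * - hp1 h12 h23 ht3 hr12 ht5; omega) (by clear * - ht6 hr34 hr4m; omega)).2
  have hX6 := (hb' r₃ (by clear * - hp1 h12 h23 ht3 hr12 ht5 ht6; omega) (by clear * - hr34 hr4m; omega)).2
  -- integer columns, then the fields of the system one by one (each `omega` sees few disjunctions)
  obtain ⟨c1, hC1⟩ := Int.eq_ofNat_of_zero_le hx2.le
  obtain ⟨c2, hC2⟩ := Int.eq_ofNat_of_zero_le hx3.le
  obtain ⟨c3, hC3⟩ := Int.eq_ofNat_of_zero_le hx4.le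
  obtain ⟨c4, hC4⟩ := Int.eq_ofNat_of_zero_le hx5.le
  obtain ⟨c5, hC5⟩ := Int.eq_ofNat_of_zero_le hx6.le
  obtain ⟨c6, hC6⟩ := Int.eq_ofNat_of_zero_le hx7.le
  obtain ⟨c7, hC7⟩ := Int.eq_ofNat_of_zero_le (show (0 : ℤ) ≤ ω r₄ 0 by clear * - hwall; omega)
  clear hrun1 hrun2 hrun3 hrun4 hrun5 hrun6 hrun7 hR8 hhor hmD hR0 hb' hbr hirr he₁ he₂ he₃ he₄ he₅ he₆ he₇ hppar1
    hP1x hP1y hmem hinj hbw hb1 hb2 hb3 hb4 hb5 hb6 hb7 hpw hw ha hh hs hhp h0 hX0 hn1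
  refine ⟨c1, c2, c3, c4, c5, c6, c7, hC1.symm, hC2.symm, hC3.symm, hC4.symm, hC5.symm, hC6.symm, hC7.symm, hs_eq, ?_⟩
  have row24 : (c1 < c3 ∧ c1 < c4 ∧ c2 < c3 ∧ c2 < c4) ∨ (c3 < c1 ∧ c4 < c1 ∧ c3 < c2 ∧ c4 < c2) := by
    clear * - hrow24 hC1 hC2 hC3 hC4; omega
  have row26 : (c1 < c5 ∧ c1 < c6 ∧ c2 < c5 ∧ c2 < c6) ∨ (c5 < c1 ∧ c6 < c1 ∧ c5 < c2 ∧ c6 < c2) := by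
    clear * - hrow26 hC1 hC2 hC5 hC6; omega
  have row46 : (c3 < c5 ∧ c3 < c6 ∧ c4 < c5 ∧ c4 < c6) ∨ (c5 < c3 ∧ c6 < c3 ∧ c5 < c4 ∧ c6 < c4) := by
    clear * - hrow46 hC3 hC4 hC5 hC6; omega
  have row15 : (p₁ < c4 ∧ p₁ < c5 ∧ c1 < c4 ∧ c1 < c5) ∨ (c4 < p₁ ∧ c5 < p₁ ∧ c4 < c1 ∧ c5 < c1) := by
    clear * - hrow15 hC1 hC4 hC5; omega
  have row17 : (p₁ < c6 ∧ p₁ < c7 ∧ c1 < c6 ∧ c1 < c7) ∨ (c6 < p₁ ∧ c7 < p₁ ∧ c6 < c1 ∧ c7 < c1) := by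
    clear * - hrow17 hC1 hC6 hC7; omega
  have row57 : (c4 < c6 ∧ c4 < c7 ∧ c5 < c6 ∧ c5 < c7) ∨ (c6 < c4 ∧ c7 < c4 ∧ c6 < c5 ∧ c7 < c5) := by
    clear * - hrow57 hC4 hC5 hC6 hC7; omega
  clear hrow24 hrow26 hrow46 hrow15 hrow17 hrow57
  have lo : p₁ ≤ 2 ∨ c1 ≤ 2 ∨ c2 ≤ 2 ∨ c3 ≤ 2 ∨ c4 ≤ 2 ∨ c5 ≤ 2 ∨ c6 ≤ 2 ∨ c7 ≤ 2 := by
    clear * - hlo hC1 hC2 hC3 hC4 hC5 hC6; omega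
  have hi : m - r₄ - 1 ≤ 2 ∨ c7 + (m - r₄ - 1) ≤ c1 + 1 ∨ c7 + (m - r₄ - 1) ≤ c2 + 1 ∨
      c7 + (m - r₄ - 1) ≤ c3 + 1 ∨ c7 + (m - r₄ - 1) ≤ c4 + 1 ∨ c7 + (m - r₄ - 1) ≤ c5 + 1 ∨
      c7 + (m - r₄ - 1) ≤ c6 + 1 ∨ c7 + (m - r₄ - 1) ≤ p₁ + 1 := by
    clear * - hhi hM hC1 hC2 hC3 hC4 hC5 hC6 hC7 hr4m; omega
  clear hlo hhi
  have e1 : c1 = p₁ + (p₂ - p₁ - 1) ∨ c1 + (p₂ - p₁ - 1) = p₁ := by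
    clear * - E1 hC1 h12; omega
  have e2 : c2 = c1 + (p₃ - p₂ - 1) ∨ c2 + (p₃ - p₂ - 1) = c1 := by
    clear * - E2 hC1 hC2 h23; omega
  have e3 : c3 = c2 + (r₁ - p₃ - 1) ∨ c3 + (r₁ - p₃ - 1) = c2 := by
    clear * - E3 hC2 hC3 ht3; omega
  have e4 : c4 = c3 + (r₂ - r₁ - 1) ∨ c4 + (r₂ - r₁ - 1) = c3 := by
    clear * - E4 hC3 hC4 hr12; omega
  have e5 : c5 = c4 + (p₄ - r₂ - 1) ∨ c5 + (p₄ - r₂ - 1) = c4 := by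
    clear * - E5 hC4 hC5 ht5; omega
  have e6 : c6 = c5 + (r₃ - p₄ - 1) ∨ c6 + (r₃ - p₄ - 1) = c5 := by
    clear * - E6 hC5 hC6 ht6; omega
  have e7 : c7 = c6 + (r₄ - r₃ - 1) ∨ c7 + (r₄ - r₃ - 1) = c6 := by
    clear * - E7 hC6 hC7 hr34; omega
  clear E1 E2 E3 E4 E5 E6 E7
  have hp1' : (p₂ - p₁ - 1) % 2 = 1 := by clear * - e1 hpodd hq2 hC1 h12; omega
  have hp2' : (p₃ - p₂ - 1) % 2 = 1 := by clear * - e2 hq2 hq3 hC1 hC2 h23; omega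
  have hp3' : (r₁ - p₃ - 1) % 2 = 0 := by clear * - e3 hq3 hq4 hC2 hC3 ht3; omega
  have hp4' : (r₂ - r₁ - 1) % 2 = 1 := by clear * - e4 hq4 hq5 hC3 hC4 hr12; omega
  have hp5' : (p₄ - r₂ - 1) % 2 = 0 := by clear * - e5 hq5 hq6 hC4 hC5 ht5; omega
  have hp6' : (r₃ - p₄ - 1) % 2 = 0 := by clear * - e6 hq6 hq7 hC5 hC6 ht6; omega
  have hp7' : (r₄ - r₃ - 1) % 2 = 1 := by clear * - e7 hq7 hq8 hC6 hC7 hr34; omega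
  have hh1 : 1 ≤ p₂ - p₁ - 1 := by clear * - hg1 e1 hpodd hq2 hC1 h12; omega
  have hh2 : 1 ≤ p₃ - p₂ - 1 := by clear * - hg2 e2 hq2 hq3 hC1 hC2 h23; omega
  have hh3 : 1 ≤ r₁ - p₃ - 1 := by clear * - hg3 e3 hq3 hq4 hC2 hC3 ht3; omega
  have hh4 : 1 ≤ r₂ - r₁ - 1 := by clear * - e4 hq4 hq5 hC3 hC4 hr12; omega
  have hh5 : 1 ≤ p₄ - r₂ - 1 := by clear * - hg5 e5 hq5 hq6 hC4 hC5 ht5; omega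
  have hh6 : 1 ≤ r₃ - p₄ - 1 := by clear * - hg6 e6 hq6 hq7 hC5 hC6 ht6; omega
  have hh7 : 1 ≤ r₄ - r₃ - 1 := by clear * - e7 hq7 hq8 hC6 hC7 hr34; omega
  have hX1' : c1 ≤ c7 + (m - r₄ - 1) := by clear * - hX1 hM hC1 hC7 hr4m; omega
  have hX2' : c2 ≤ c7 + (m - r₄ - 1) := by clear * - hX2 hM hC2 hC7 hr4m; omega
  have hX3' : c3 ≤ c7 + (m - r₄ - 1) := by clear * - hX3 hM hC3 hC7 hr4m; omega
  have hX4' : c4 ≤ c7 + (m - r₄ - 1) := by clear * - hX4 hM hC4 hC7 hr4m; omega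
  have hX5' : c5 ≤ c7 + (m - r₄ - 1) := by clear * - hX5 hM hC5 hC7 hr4m; omega
  have hX6' : c6 ≤ c7 + (m - r₄ - 1) := by clear * - hX6 hM hC6 hC7 hr4m; omega
  exact
    { hk := hk, hlen := by clear * - hm h12 h23 ht3 hr12 ht5 ht6 hr34 hr4m; omega,
      hvis := by clear * - hs_eq hr4m; omega, hf := by clear * - hs_eq hpodd hr4m; omega, hpp := hpodd,
      hp1 := hp1', hp2 := hp2', hp3 := hp3', hp4 := hp4', hp5 := hp5', hp6 := hp6', hp7 := hp7', hh1 := hh1,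
      hh2 := hh2, hh3 := hh3, hh4 := hh4, hh5 := hh5, hh6 := hh6, hh7 := hh7, e1 := e1, e2 := e2, e3 := e3,
      e4 := e4, e5 := e5, e6 := e6, e7 := e7, row24 := row24, row26 := row26, row46 := row46, row15 := row15,
      row17 := row17, row57 := row57, wall := by clear * - hwall hC7; omega, x1 := by clear * - hx2 hC1; omega,
      x2 := by clear * - hx3 hC2; omega, x3 := by clear * - hx4 hC3; omega, x4 := by clear * - hx5 hC4; omega,
      x5 := by clear * - hx6 hC5; omega, x6 := by clear * - hx7 hC6; omega, X1 := hX1', X2 := hX2', X3 := hX3',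
      X4 := hX4', X5 := hX5', X6 := hX6', irrlo := lo, irrhi := hi }

/-- **The constraint system of a `D D U D D U U U` block at slack four.** For an irreducible positive wall bridge of
length `6k + 4` (`k ≥ 2`) with `k` wall visits and vertical steps in the order `D D U D D U U U` (down times
`p₁ < p₂ < p₃ < p₄`, up times `r₁ < r₂ < r₃ < r₄`), the columns `c₁ … c₇` of the vertical steps 2, …, 8 are natural
numbers and, with `p = p₁`, `f = m − r₄ − 1` and the run lengths `hⱼ = tⱼ₊₁ − tⱼ − 1`, satisfy `Ddudduuu4Hyp`
(`…SlackFourFourDownHyp`): LEN, VIS (`r₄ + 2k + 1 = m + p₁`), PAR (brick-wall parities of the step columns and of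
`X`), positive runs, SIGNS (the runs of `ddudduuu4_runs`), ROWS (runs 2, 4 on row `−2`; runs 2, 6 on row `−2`; runs
4, 6 on row `−2`; runs 1, 3 on row `−1`; runs 1, 7 on row `−1`; runs 3, 7 on row `−1`: `row_runs_apart` +
self-avoidance), WALL (`resurface_right_of_initial_run`), XRNG (bridge), IRR (`four_down_shield_low/high`).
Four-down analogue of `ddduuu4_families` (`…SlackFourThreeDownSystems`) up to the table. OURS.
[cite: MadrasSlade1993, §4.2, Definition 4.2.1 (p. 90), remark before (4.2.21) (p. 94)]
[cite: EntingJensen2009, §7.4.2, Fig. 7.10] -/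
theorem ddudduuu4_hyp {k m : ℕ}
    (hk : 2 ≤ k) (hm : m = 6 * k + 4) (hω : ω ∈ ipwb m) (hv : visits m ω = k) {p₁ p₂ p₃ p₄ r₁ r₂ r₃ r₄ : ℕ}
    (hD : stepsD m ω = {p₁, p₂, p₃, p₄}) (hU : stepsU m ω = {r₁, r₂, r₃, r₄}) (h12 : p₁ < p₂) (h23 : p₂ < p₃)
    (h34 : p₃ < p₄) (hr12 : r₁ < r₂) (hr23 : r₂ < r₃) (hr34 : r₃ < r₄) (ht2 : p₂ < r₁) (ht3 : r₁ < p₃) (ht5 : p₄ < r₂)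
    (hp1 : 1 ≤ p₁) (hR0 : ∀ i, i ≤ p₁ → ω i 0 = i ∧ ω i 1 = 0) (hP1x : ω (p₁ + 1) 0 = p₁) (hP1y : ω (p₁ + 1) 1 = -1)
    (hhor : ∀ i, i < m → i ∉ stepsD m ω → i ∉ stepsU m ω → ω (i + 1) 1 = ω i 1 ∧
        (ω (i + 1) 0 = ω i 0 + 1 ∨ ω (i + 1) 0 = ω i 0 - 1)) :
    ∃ c1 c2 c3 c4 c5 c6 c7 : ℕ, (c1 : ℤ) = ω p₂ 0 ∧ (c2 : ℤ) = ω r₁ 0 ∧ (c3 : ℤ) = ω p₃ 0 ∧ (c4 : ℤ) = ω p₄ 0 ∧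
      (c5 : ℤ) = ω r₂ 0 ∧ (c6 : ℤ) = ω r₃ 0 ∧ (c7 : ℤ) = ω r₄ 0 ∧ r₄ + 2 * k + 1 = m + p₁ ∧
      Ddudduuu4Hyp k p₁ (m - r₄ - 1) (p₂ - p₁ - 1) (r₁ - p₂ - 1) (p₃ - r₁ - 1) (p₄ - p₃ - 1) (r₂ - p₄ - 1)
          (r₃ - r₂ - 1) (r₄ - r₃ - 1) c1 c2 c3 c4 c5 c6 c7 := by
  classical
  obtain ⟨hpw, hn1, hirr⟩ := mem_ipwb.1 hω
  obtain ⟨hw, hbr⟩ := mem_pwb.1 hpw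
  obtain ⟨ha, -⟩ := mem_wbr.1 hw
  obtain ⟨hh, -, -⟩ := mem_archs.1 ha
  obtain ⟨hs, hhp⟩ := mem_hpw.1 hh
  obtain ⟨h0, -, hbw, hinj⟩ := mem_saws_iff.1 hs
  have hX0 : ω 0 0 = 0 := by rw [h0]; rfl
  have hb' : ∀ i, 1 ≤ i → i ≤ m → 0 < ω i 0 ∧ ω i 0 ≤ ω m 0 := fun i h1 h2 => by
    have := hbr i h1 h2; rwa [hX0] at this
  have hmem : ∀ i, i ≤ m → i ∈ {i | i ≤ m} := fun i hi => hi
  have hmD : ∀ i, i ∈ stepsD m ω ↔ i = p₁ ∨ i = p₂ ∨ i = p₃ ∨ i = p₄ := fun i => by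
    rw [hD]; simp only [Finset.mem_insert, Finset.mem_singleton]
  obtain ⟨-, -, -, hppar1⟩ := of_mem_stepsD_coord hbw (i := p₁) ((hmD _).2 (by simp))
  have hpodd : p₁ % 2 = 1 := by rw [hP1x, hP1y] at hppar1; omega
  obtain ⟨e₁, e₂, e₃, e₄, e₅, e₆, e₇, he₁, he₂, he₃, he₄, he₅, he₆, he₇, hrun1, hrun2, hrun3, hrun4, hrun5,
      hrun6, hrun7, hR8, hs_eq, hN, hq2, hq3, hq4, hq5, hq6, hq7, hq8, hx2, hx3, hx4, hx5, hx6, hx7,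
      hg1, hg2, hg3, hg4, hg5, hr4m⟩ :=
    ddudduuu4_runs hm hω hv hD hU h12 h23 h34 hr12 hr23 hr34 ht2 ht3 ht5 hp1 hR0 hP1x hP1y hhor
  -- the end columns of the seven body runs and of the final run; `X` is even
  have hb1 := (hrun1 p₂ (Nat.succ_le_of_lt h12) le_rfl).1
  have hb2 := (hrun2 r₁ (Nat.succ_le_of_lt ht2) le_rfl).1
  have hb3 := (hrun3 p₃ (Nat.succ_le_of_lt ht3) le_rfl).1
  have hb4 := (hrun4 p₄ (Nat.succ_le_of_lt h34) le_rfl).1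
  have hb5 := (hrun5 r₂ (Nat.succ_le_of_lt ht5) le_rfl).1
  have hb6 := (hrun6 r₃ (Nat.succ_le_of_lt hr23) le_rfl).1
  have hb7 := (hrun7 r₄ (Nat.succ_le_of_lt hr34) le_rfl).1
  have hM := (hR8 m (Nat.succ_le_of_lt hr4m) le_rfl).1
  -- WALL: the resurfacing column lies right of the initial run
  have hwall : (p₁ : ℤ) + 1 ≤ ω r₄ 0 :=
    resurface_right_of_initial_run hinj (fun i h1 h2 => (hb' i h1 h2).1)
        (by clear * - h12 ht2 ht3 h34 ht5 hr23 hr34; omega) hr4m hR0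
      hR8
  -- ROWS: the runs sharing a row are separated (self-avoidance)
  have hrow24 := row_runs_apart (a := ω p₂ 0) (c := ω p₃ 0) he₂ he₄ (Nat.succ_le_of_lt ht2)
    (Nat.succ_le_of_lt h34) (fun i h1 h2 => (hrun2 i h1 h2).1) (fun j h1 h2 => (hrun4 j h1 h2).1)
    (fun i j hi1 hi2 hj1 hj2 hx => by
      have := hinj (hmem i (by clear * - hi2 ht3 h34 ht5 hr23 hr34 hr4m; omega))
          (hmem j (by clear * - hj2 h34 ht5 hr23 hr34 hr4m; omega))
        (site_ext_d4s hx (by rw [(hrun2 i hi1 hi2).2, (hrun4 j hj1 hj2).2]))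
      clear * - this hi2 hj1 ht3
      omega)
  have hrow26 := row_runs_apart (a := ω p₂ 0) (c := ω r₂ 0) he₂ he₆ (Nat.succ_le_of_lt ht2)
    (Nat.succ_le_of_lt hr23) (fun i h1 h2 => (hrun2 i h1 h2).1) (fun j h1 h2 => (hrun6 j h1 h2).1)
    (fun i j hi1 hi2 hj1 hj2 hx => by
      have := hinj (hmem i (by clear * - hi2 ht3 h34 ht5 hr23 hr34 hr4m; omega))
          (hmem j (by clear * - hj2 hr23 hr34 hr4m; omega))
        (site_ext_d4s hx (by rw [(hrun2 i hi1 hi2).2, (hrun6 j hj1 hj2).2]))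
      clear * - this hi2 hj1 ht3 h34 ht5
      omega)
  have hrow46 := row_runs_apart (a := ω p₃ 0) (c := ω r₂ 0) he₄ he₆ (Nat.succ_le_of_lt h34)
    (Nat.succ_le_of_lt hr23) (fun i h1 h2 => (hrun4 i h1 h2).1) (fun j h1 h2 => (hrun6 j h1 h2).1)
    (fun i j hi1 hi2 hj1 hj2 hx => by
      have := hinj (hmem i (by clear * - hi2 ht5 hr23 hr34 hr4m; omega))
          (hmem j (by clear * - hj2 hr23 hr34 hr4m; omega))
        (site_ext_d4s hx (by rw [(hrun4 i hi1 hi2).2, (hrun6 j hj1 hj2).2]))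
      clear * - this hi2 hj1 ht5
      omega)
  have hrow13 := row_runs_apart (a := (p₁ : ℤ)) (c := ω r₁ 0) he₁ he₃ (Nat.succ_le_of_lt h12)
    (Nat.succ_le_of_lt ht3) (fun i h1 h2 => (hrun1 i h1 h2).1) (fun j h1 h2 => (hrun3 j h1 h2).1)
    (fun i j hi1 hi2 hj1 hj2 hx => by
      have := hinj (hmem i (by clear * - hi2 ht2 ht3 h34 ht5 hr23 hr34 hr4m; omega))
          (hmem j (by clear * - hj2 ht3 h34 ht5 hr23 hr34 hr4m; omega))
        (site_ext_d4s hx (by rw [(hrun1 i hi1 hi2).2, (hrun3 j hj1 hj2).2]))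
      clear * - this hi2 hj1 ht2
      omega)
  have hrow17 := row_runs_apart (a := (p₁ : ℤ)) (c := ω r₃ 0) he₁ he₇ (Nat.succ_le_of_lt h12)
    (Nat.succ_le_of_lt hr34) (fun i h1 h2 => (hrun1 i h1 h2).1) (fun j h1 h2 => (hrun7 j h1 h2).1)
    (fun i j hi1 hi2 hj1 hj2 hx => by
      have := hinj (hmem i (by clear * - hi2 ht2 ht3 h34 ht5 hr23 hr34 hr4m; omega))
          (hmem j (by clear * - hj2 hr34 hr4m; omega))
        (site_ext_d4s hx (by rw [(hrun1 i hi1 hi2).2, (hrun7 j hj1 hj2).2]))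
      clear * - this hi2 hj1 ht2 ht3 h34 ht5 hr23
      omega)
  have hrow37 := row_runs_apart (a := ω r₁ 0) (c := ω r₃ 0) he₃ he₇ (Nat.succ_le_of_lt ht3)
    (Nat.succ_le_of_lt hr34) (fun i h1 h2 => (hrun3 i h1 h2).1) (fun j h1 h2 => (hrun7 j h1 h2).1)
    (fun i j hi1 hi2 hj1 hj2 hx => by
      have := hinj (hmem i (by clear * - hi2 h34 ht5 hr23 hr34 hr4m; omega))
          (hmem j (by clear * - hj2 hr34 hr4m; omega))
        (site_ext_d4s hx (by rw [(hrun3 i hi1 hi2).2, (hrun7 j hj1 hj2).2]))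
      clear * - this hi2 hj1 h34 ht5 hr23
      omega)
  -- SIGNS, sign-free
  have E1 : ω p₂ 0 = p₁ + ((p₂ - p₁ - 1 : ℕ) : ℤ) ∨ ω p₂ 0 + ((p₂ - p₁ - 1 : ℕ) : ℤ) = p₁ := by
    clear * - he₁ hb1 h12; rcases he₁ with rfl | rfl <;> omega
  have E2 : ω r₁ 0 = ω p₂ 0 + ((r₁ - p₂ - 1 : ℕ) : ℤ) ∨ ω r₁ 0 + ((r₁ - p₂ - 1 : ℕ) : ℤ) = ω p₂ 0 := by
    clear * - he₂ hb2 ht2; rcases he₂ with rfl | rfl <;> omega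
  have E3 : ω p₃ 0 = ω r₁ 0 + ((p₃ - r₁ - 1 : ℕ) : ℤ) ∨ ω p₃ 0 + ((p₃ - r₁ - 1 : ℕ) : ℤ) = ω r₁ 0 := by
    clear * - he₃ hb3 ht3; rcases he₃ with rfl | rfl <;> omega
  have E4 : ω p₄ 0 = ω p₃ 0 + ((p₄ - p₃ - 1 : ℕ) : ℤ) ∨ ω p₄ 0 + ((p₄ - p₃ - 1 : ℕ) : ℤ) = ω p₃ 0 := by
    clear * - he₄ hb4 h34; rcases he₄ with rfl | rfl <;> omega
  have E5 : ω r₂ 0 = ω p₄ 0 + ((r₂ - p₄ - 1 : ℕ) : ℤ) ∨ ω r₂ 0 + ((r₂ - p₄ - 1 : ℕ) : ℤ) = ω p₄ 0 := by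
    clear * - he₅ hb5 ht5; rcases he₅ with rfl | rfl <;> omega
  have E6 : ω r₃ 0 = ω r₂ 0 + ((r₃ - r₂ - 1 : ℕ) : ℤ) ∨ ω r₃ 0 + ((r₃ - r₂ - 1 : ℕ) : ℤ) = ω r₂ 0 := by
    clear * - he₆ hb6 hr23; rcases he₆ with rfl | rfl <;> omega
  have E7 : ω r₄ 0 = ω r₃ 0 + ((r₄ - r₃ - 1 : ℕ) : ℤ) ∨ ω r₄ 0 + ((r₄ - r₃ - 1 : ℕ) : ℤ) = ω r₃ 0 := by
    clear * - he₇ hb7 hr34; rcases he₇ with rfl | rfl <;> omega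
  -- IRR: the two shields
  have hlo : p₁ ≤ 2 ∨ ω p₂ 0 ≤ 2 ∨ ω r₁ 0 ≤ 2 ∨ ω p₃ 0 ≤ 2 ∨ ω p₄ 0 ≤ 2 ∨ ω r₂ 0 ≤ 2 ∨ ω r₃ 0 ≤ 2 := by
    rcases Nat.lt_or_ge p₁ 3 with h | h
    · exact Or.inl (by clear * - h; omega)
    · exact Or.inr (four_down_shield_low hbr hirr hR0 he₁ he₂ he₃ he₄ he₅ he₆ he₇
        (fun i h1 h2 => (hrun1 i h1 h2).1) (fun i h1 h2 => (hrun2 i h1 h2).1) (fun i h1 h2 => (hrun3 i h1 h2).1)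
        (fun i h1 h2 => (hrun4 i h1 h2).1) (fun i h1 h2 => (hrun5 i h1 h2).1) (fun i h1 h2 => (hrun6 i h1 h2).1)
        (fun i h1 h2 => (hrun7 i h1 h2).1) hR8 h h12 ht2 ht3 h34 ht5 hr23 hr34 hr4m hwall)
  have hhi : m - r₄ - 1 ≤ 2 ∨ ω m 0 ≤ ω p₂ 0 + 1 ∨ ω m 0 ≤ ω r₁ 0 + 1 ∨ ω m 0 ≤ ω p₃ 0 + 1 ∨
      ω m 0 ≤ ω p₄ 0 + 1 ∨ ω m 0 ≤ ω r₂ 0 + 1 ∨ ω m 0 ≤ ω r₃ 0 + 1 := by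
    rcases Nat.lt_or_ge (m - r₄ - 1) 3 with h | h
    · exact Or.inl (by clear * - h; omega)
    · exact Or.inr (four_down_shield_high hbr hirr hR0 he₁ he₂ he₃ he₄ he₅ he₆ he₇
        (fun i h1 h2 => (hrun1 i h1 h2).1) (fun i h1 h2 => (hrun2 i h1 h2).1) (fun i h1 h2 => (hrun3 i h1 h2).1)
        (fun i h1 h2 => (hrun4 i h1 h2).1) (fun i h1 h2 => (hrun5 i h1 h2).1) (fun i h1 h2 => (hrun6 i h1 h2).1)
        (fun i h1 h2 => (hrun7 i h1 h2).1) hR8 (by clear * - h hr4m; omega) (by clear * - hm; omega) h12 ht2 ht3 h34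
        ht5 hr23 hr34 hwall)
  -- XRNG: the bridge range
  have hX1 := (hb' p₂ (by clear * - hp1 h12; omega) (by clear * - ht2 ht3 h34 ht5 hr23 hr34 hr4m; omega)).2
  have hX2 := (hb' r₁ (by clear * - hp1 h12 ht2; omega) (by clear * - ht3 h34 ht5 hr23 hr34 hr4m; omega)).2
  have hX3 := (hb' p₃ (by clear * - hp1 h12 ht2 ht3; omega) (by clear * - h34 ht5 hr23 hr34 hr4m; omega)).2
  have hX4 := (hb' p₄ (by clear * - hp1 h12 ht2 ht3 h34; omega) (by clear * - ht5 hr23 hr34 hr4m; omega)).2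
  have hX5 := (hb' r₂ (by clear * - hp1 h12 ht2 ht3 h34 ht5; omega) (by clear * - hr23 hr34 hr4m; omega)).2
  have hX6 := (hb' r₃ (by clear * - hp1 h12 ht2 ht3 h34 ht5 hr23; omega) (by clear * - hr34 hr4m; omega)).2
  -- integer columns, then the fields of the system one by one (each `omega` sees few disjunctions)
  obtain ⟨c1, hC1⟩ := Int.eq_ofNat_of_zero_le hx2.le
  obtain ⟨c2, hC2⟩ := Int.eq_ofNat_of_zero_le hx3.le
  obtain ⟨c3, hC3⟩ := Int.eq_ofNat_of_zero_le hx4.le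
  obtain ⟨c4, hC4⟩ := Int.eq_ofNat_of_zero_le hx5.le
  obtain ⟨c5, hC5⟩ := Int.eq_ofNat_of_zero_le hx6.le
  obtain ⟨c6, hC6⟩ := Int.eq_ofNat_of_zero_le hx7.le
  obtain ⟨c7, hC7⟩ := Int.eq_ofNat_of_zero_le (show (0 : ℤ) ≤ ω r₄ 0 by clear * - hwall; omega)
  clear hrun1 hrun2 hrun3 hrun4 hrun5 hrun6 hrun7 hR8 hhor hmD hR0 hb' hbr hirr he₁ he₂ he₃ he₄ he₅ he₆ he₇ hppar1
    hP1x hP1y hmem hinj hbw hb1 hb2 hb3 hb4 hb5 hb6 hb7 hpw hw ha hh hs hhp h0 hX0 hn1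
  refine ⟨c1, c2, c3, c4, c5, c6, c7, hC1.symm, hC2.symm, hC3.symm, hC4.symm, hC5.symm, hC6.symm, hC7.symm, hs_eq, ?_⟩
  have row24 : (c1 < c3 ∧ c1 < c4 ∧ c2 < c3 ∧ c2 < c4) ∨ (c3 < c1 ∧ c4 < c1 ∧ c3 < c2 ∧ c4 < c2) := by
    clear * - hrow24 hC1 hC2 hC3 hC4; omega
  have row26 : (c1 < c5 ∧ c1 < c6 ∧ c2 < c5 ∧ c2 < c6) ∨ (c5 < c1 ∧ c6 < c1 ∧ c5 < c2 ∧ c6 < c2) := by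
    clear * - hrow26 hC1 hC2 hC5 hC6; omega
  have row46 : (c3 < c5 ∧ c3 < c6 ∧ c4 < c5 ∧ c4 < c6) ∨ (c5 < c3 ∧ c6 < c3 ∧ c5 < c4 ∧ c6 < c4) := by
    clear * - hrow46 hC3 hC4 hC5 hC6; omega
  have row13 : (p₁ < c2 ∧ p₁ < c3 ∧ c1 < c2 ∧ c1 < c3) ∨ (c2 < p₁ ∧ c3 < p₁ ∧ c2 < c1 ∧ c3 < c1) := by
    clear * - hrow13 hC1 hC2 hC3; omega
  have row17 : (p₁ < c6 ∧ p₁ < c7 ∧ c1 < c6 ∧ c1 < c7) ∨ (c6 < p₁ ∧ c7 < p₁ ∧ c6 < c1 ∧ c7 < c1) := by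
    clear * - hrow17 hC1 hC6 hC7; omega
  have row37 : (c2 < c6 ∧ c2 < c7 ∧ c3 < c6 ∧ c3 < c7) ∨ (c6 < c2 ∧ c7 < c2 ∧ c6 < c3 ∧ c7 < c3) := by
    clear * - hrow37 hC2 hC3 hC6 hC7; omega
  clear hrow24 hrow26 hrow46 hrow13 hrow17 hrow37
  have lo : p₁ ≤ 2 ∨ c1 ≤ 2 ∨ c2 ≤ 2 ∨ c3 ≤ 2 ∨ c4 ≤ 2 ∨ c5 ≤ 2 ∨ c6 ≤ 2 ∨ c7 ≤ 2 := by
    clear * - hlo hC1 hC2 hC3 hC4 hC5 hC6; omega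
  have hi : m - r₄ - 1 ≤ 2 ∨ c7 + (m - r₄ - 1) ≤ c1 + 1 ∨ c7 + (m - r₄ - 1) ≤ c2 + 1 ∨
      c7 + (m - r₄ - 1) ≤ c3 + 1 ∨ c7 + (m - r₄ - 1) ≤ c4 + 1 ∨ c7 + (m - r₄ - 1) ≤ c5 + 1 ∨
      c7 + (m - r₄ - 1) ≤ c6 + 1 ∨ c7 + (m - r₄ - 1) ≤ p₁ + 1 := by
    clear * - hhi hM hC1 hC2 hC3 hC4 hC5 hC6 hC7 hr4m; omega
  clear hlo hhi
  have e1 : c1 = p₁ + (p₂ - p₁ - 1) ∨ c1 + (p₂ - p₁ - 1) = p₁ := by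
    clear * - E1 hC1 h12; omega
  have e2 : c2 = c1 + (r₁ - p₂ - 1) ∨ c2 + (r₁ - p₂ - 1) = c1 := by
    clear * - E2 hC1 hC2 ht2; omega
  have e3 : c3 = c2 + (p₃ - r₁ - 1) ∨ c3 + (p₃ - r₁ - 1) = c2 := by
    clear * - E3 hC2 hC3 ht3; omega
  have e4 : c4 = c3 + (p₄ - p₃ - 1) ∨ c4 + (p₄ - p₃ - 1) = c3 := by
    clear * - E4 hC3 hC4 h34; omega
  have e5 : c5 = c4 + (r₂ - p₄ - 1) ∨ c5 + (r₂ - p₄ - 1) = c4 := by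
    clear * - E5 hC4 hC5 ht5; omega
  have e6 : c6 = c5 + (r₃ - r₂ - 1) ∨ c6 + (r₃ - r₂ - 1) = c5 := by
    clear * - E6 hC5 hC6 hr23; omega
  have e7 : c7 = c6 + (r₄ - r₃ - 1) ∨ c7 + (r₄ - r₃ - 1) = c6 := by
    clear * - E7 hC6 hC7 hr34; omega
  clear E1 E2 E3 E4 E5 E6 E7
  have hp1' : (p₂ - p₁ - 1) % 2 = 1 := by clear * - e1 hpodd hq2 hC1 h12; omega
  have hp2' : (r₁ - p₂ - 1) % 2 = 0 := by clear * - e2 hq2 hq3 hC1 hC2 ht2; omega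
  have hp3' : (p₃ - r₁ - 1) % 2 = 0 := by clear * - e3 hq3 hq4 hC2 hC3 ht3; omega
  have hp4' : (p₄ - p₃ - 1) % 2 = 1 := by clear * - e4 hq4 hq5 hC3 hC4 h34; omega
  have hp5' : (r₂ - p₄ - 1) % 2 = 0 := by clear * - e5 hq5 hq6 hC4 hC5 ht5; omega
  have hp6' : (r₃ - r₂ - 1) % 2 = 1 := by clear * - e6 hq6 hq7 hC5 hC6 hr23; omega
  have hp7' : (r₄ - r₃ - 1) % 2 = 1 := by clear * - e7 hq7 hq8 hC6 hC7 hr34; omega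
  have hh1 : 1 ≤ p₂ - p₁ - 1 := by clear * - hg1 e1 hpodd hq2 hC1 h12; omega
  have hh2 : 1 ≤ r₁ - p₂ - 1 := by clear * - hg2 e2 hq2 hq3 hC1 hC2 ht2; omega
  have hh3 : 1 ≤ p₃ - r₁ - 1 := by clear * - hg3 e3 hq3 hq4 hC2 hC3 ht3; omega
  have hh4 : 1 ≤ p₄ - p₃ - 1 := by clear * - hg4 e4 hq4 hq5 hC3 hC4 h34; omega
  have hh5 : 1 ≤ r₂ - p₄ - 1 := by clear * - hg5 e5 hq5 hq6 hC4 hC5 ht5; omega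
  have hh6 : 1 ≤ r₃ - r₂ - 1 := by clear * - e6 hq6 hq7 hC5 hC6 hr23; omega
  have hh7 : 1 ≤ r₄ - r₃ - 1 := by clear * - e7 hq7 hq8 hC6 hC7 hr34; omega
  have hX1' : c1 ≤ c7 + (m - r₄ - 1) := by clear * - hX1 hM hC1 hC7 hr4m; omega
  have hX2' : c2 ≤ c7 + (m - r₄ - 1) := by clear * - hX2 hM hC2 hC7 hr4m; omega
  have hX3' : c3 ≤ c7 + (m - r₄ - 1) := by clear * - hX3 hM hC3 hC7 hr4m; omega
  have hX4' : c4 ≤ c7 + (m - r₄ - 1) := by clear * - hX4 hM hC4 hC7 hr4m; omega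
  have hX5' : c5 ≤ c7 + (m - r₄ - 1) := by clear * - hX5 hM hC5 hC7 hr4m; omega
  have hX6' : c6 ≤ c7 + (m - r₄ - 1) := by clear * - hX6 hM hC6 hC7 hr4m; omega
  exact
    { hk := hk, hlen := by clear * - hm h12 ht2 ht3 h34 ht5 hr23 hr34 hr4m; omega,
      hvis := by clear * - hs_eq hr4m; omega, hf := by clear * - hs_eq hpodd hr4m; omega, hpp := hpodd,
      hp1 := hp1', hp2 := hp2', hp3 := hp3', hp4 := hp4', hp5 := hp5', hp6 := hp6', hp7 := hp7', hh1 := hh1,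
      hh2 := hh2, hh3 := hh3, hh4 := hh4, hh5 := hh5, hh6 := hh6, hh7 := hh7, e1 := e1, e2 := e2, e3 := e3,
      e4 := e4, e5 := e5, e6 := e6, e7 := e7, row24 := row24, row26 := row26, row46 := row46, row13 := row13,
      row17 := row17, row37 := row37, wall := by clear * - hwall hC7; omega, x1 := by clear * - hx2 hC1; omega,
      x2 := by clear * - hx3 hC2; omega, x3 := by clear * - hx4 hC3; omega, x4 := by clear * - hx5 hC4; omega,
      x5 := by clear * - hx6 hC5; omega, x6 := by clear * - hx7 hC6; omega, X1 := hX1', X2 := hX2', X3 := hX3',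
      X4 := hX4', X5 := hX5', X6 := hX6', irrlo := lo, irrhi := hi }

end Literature.Probability.RandomPlanarGeometry.SAW.HexBW.Wall
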